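import Literature.Computability.FineGrained.SerfSNPProofs
import Literature.Computability.Complexity.CodeFPLists
import Literature.Computability.Complexity.CodeFPFinite
import Literature.Computability.Complexity.CNFInvariance
import HarnessLib

/-!
# `k`-SAT is (SERF-equivalent to) an SNP problem — discharge of `exists_snp_kSAT`

Sibling proof file of `SerfSNP.lean` (D-0014: a named fact `def X : Prop` is discharged as
`theorem X_holds : X`). It discharges

* `Literature.Computability.FineGrained.exists_snp_kSAT_holds : exists_snp_kSAT` — for every `k` there is an
  SNP formula `Φ` with `SERFReducible (kSATParam k) Φ.toParamProblem` and
  `SERFReducible Φ.toParamProblem (kSATParam k)`.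

Source. Impagliazzo–Paturi–Zane, *Which problems have strongly exponential complexity?*, JCSS 63 (2001),
§3, proof of Thm. 3, the paragraph "`k`-SAT is in SNP": a `k`-CNF on the variables `x_0, …, x_{n-1}` is the
finite structure with universe `{0, …, n-1}` and `2^k` input relations `R_s` of arity `k`, one for each sign
pattern `s ∈ {0,1}^k`, `R_s(y_1, …, y_k)` holding iff the clause on the variables `ȳ` with signs `s` is present;
the witness is one unary relation `S` (the assignment), so the IPZ parameter `∑ᵢ n^{arity Sᵢ}` is `n`, and the
universal first-order part says that every present clause has a satisfied literal,
`∀ ȳ ⋀_s (R_s(ȳ) → ⋁_i (S(y_i) ↔ s_i))`. We follow this construction literally (`KSatSNP.formula`); the two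
SERF reductions are the polynomial-time re-encodings between the tree's code of `k`-CNFs (`encodingCNF`,
parameter `CNF.numVars`) and the tree's code of finite SNP instances (`encodingSNPInstance`, parameter the
universe size), each asking one oracle query whose parameter is at most the input's.

## Architecture

* `serfReducible_of_karp`: a map `f ∈ FP` that is a many-one reduction between the languages and keeps the
  parameter within a constant factor is a SERF reduction (the one-query oracle algorithm `karpAlg f` with the
  wrapped step machine `karpLift` of `OracleProofs.lean`; the argument of
  `serfReducible_kSATClauseParam_kSATParam_holds` of `SerfSNPProofs.lean`, stated once for an arbitrary map).
* `KSatSNP.formula k` (the SNP formula, on Mathlib's `FirstOrder.Language.BoundedFormula`: `iInf`/`iSup` over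
  the sign patterns and positions, `alls`; universality `KSatSNP.isUniversal_sentence`) and its semantics on
  Boolean tables: `KSatSNP.holdsOnTables_iff` (tuples `Fin k → Fin n`) and `KSatSNP.holdsOnTables_iff_ntab`
  (numeric form: sign pattern `s < 2^k`, tuple number `t < n^k` via `finFunctionFinEquiv`, clause
  `KSatSNP.clauseOf k n s t`).
* The layout of the table string of an instance (`KSatSNP.relTablesEquiv_apply`,
  `KSatSNP.getD_ofFn_relTablesEquiv`: bit `s · n^k + t` is `R_s` at the tuple numbered `t`).
* Backward (instance `→` `k`-CNF): `KSatSNP.cnfOfBits` lists the clauses of the set table bits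
  (`satisfiable_cnfOfBits_iff`, `numVars_cnfOfBits_le`); on strings `KSatSNP.backMap k` sends a well-formed
  instance code (`instOK`: it re-pairs from its header numeral and body, and the body has `2^k n^k` bits) to the
  code of that `k`-CNF and everything else to the non-member `badCode`.
* Forward (`k`-CNF `→` instance): `KSatSNP.prep` renames the occurring variables into `[0, n')`,
  `n' = newNumVars φ = min (numVars φ) (size φ)` (identity if `numVars ≤ size`, else the occurrence rank of
  `SerfRename` — both injective on the occurring variables, `CNF.satisfiable_rename_iff`), and pads every
  clause to width `k` by copies of its first literal; `KSatSNP.relOfCNF`/`bitsOfCNF` tabulate it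
  (`holdsOnTables_instOf_iff`); on strings `KSatSNP.fwdMap k` accepts canonical codes of `k`-CNFs without the
  empty clause (the others are unsatisfiable or non-codes and go to the non-code `ε`).
* Polynomial time of both string maps is assembled in the typed `CodeFP` algebra (`CodeFP*.lean`: folds, maps,
  filters, bounded ranges, numerals, `ofFintype`), with no machine written here: `backMap_mem_FP`,
  `fwdMap_mem_FP` (the table string is produced within the unit budget `(2|w|+2)^k ≥ 2^k n'^k`, `n' ≤ size ≤ |w|`).

## Design notes

* Width-`< k` clauses are padded (IPZ tacitly treat `k`-CNFs with clauses of exactly `k` literals); the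
  empty clause cannot be padded, so formulas containing it (trivially unsatisfiable) are mapped to a non-code.
* The renaming is needed because `CNF.numVars` is `1 + ` the largest variable *index*, which may be exponential
  in the code length, while the instance must be written down; `n' ≤ numVars` keeps the parameter bound and
  `n' ≤ size` keeps the table polynomial.
* Nothing here depends on `ε`: both reduction families are constant (polynomial-time Karp reductions with a
  linear parameter bound), as in the printed proof.

## References

* R. Impagliazzo, R. Paturi, F. Zane, *Which problems have strongly exponential complexity?*,
  J. Comput. System Sci. 63 (2001) 512–530, §3, proof of Thm. 3. [ImpagliazzoPaturiZaneJCSS2001]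
* C. H. Papadimitriou, M. Yannakakis, *Optimization, approximation, and complexity classes*, JCSS 43 (1991),
  §2 (SNP). [PapadimitriouYannakakis1991]
* R. E. Ladner, N. A. Lynch, A. L. Selman, *A comparison of polynomial time reducibilities*,
  Theoret. Comput. Sci. 1 (1975), p. 104 and Prop. 2.1. [LadnerLynchSelman1975]
* S. Arora, B. Barak, *Computational Complexity: A Modern Approach*, CUP 2009, §0.1 (codes), §1.3
  (closure of polynomial time under composition and bounded loops). [AroraBarak2009]
-/

namespace Literature.Computability.FineGrained

open _root_.Computability Complexity Cryptography Polynomial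

/-! ### A polynomial-time many-one reduction with linearly bounded parameter is a SERF reduction -/

/-- **Karp reductions with a linear parameter bound are SERF reductions** (the constant reduction
family). If `f ∈ FP` maps `Q₁.lang` to `Q₂.lang` as a many-one reduction and the parameter of the
image is at most `C · ` the parameter of the input, then `SERFReducible Q₁ Q₂`: the one-query oracle
algorithm `karpAlg f` with the wrapped step machine `karpLift` (`OracleProofs.lean`) runs in time
`p(|x|) + O(|x|)` on the empty transcript and in time linear in the transcript otherwise, asks the single
query `f x` (parameter `≤ C · p₁(x)`, polynomial length) and outputs the oracle's answer bit; the factor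
`2^{ε p₁(x)}` of the SERF budget is not used. (The argument of
`serfReducible_kSATClauseParam_kSATParam_holds`, stated for an arbitrary map.)
[cite: ImpagliazzoPaturiZaneJCSS2001, §2.1 (SERF reductions; every polynomial-time reduction preserving the parameter up to a constant factor is one)] -/
theorem serfReducible_of_karp {Q₁ Q₂ : ParamProblem} (f : List Bool → List Bool) (hf : f ∈ FP)
    (hmem : ∀ x, x ∈ Q₁.lang ↔ f x ∈ Q₂.lang) (C : ℕ) (hpar : ∀ x, Q₂.param (f x) ≤ C * Q₁.param x) :
    SERFReducible Q₁ Q₂ := by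
  intro ε hε
  obtain ⟨p, Mr, hMr⟩ := hf
  obtain ⟨s, hs⟩ := exists_poly_length_le_of_mem_FP (show f ∈ FP from ⟨p, Mr, hMr⟩)
  obtain ⟨C₁, hC₁, hp⟩ := exists_eval_le_mul_succ_pow p
  obtain ⟨C₂, hC₂, hsC⟩ := exists_eval_le_mul_succ_pow s
  -- the step time bound: query case `p(|x|) + 2|x| + 4`, answer case `|input|`; their sum bounds both
  let Tstep : List Bool × List (List Bool) → ℕ := fun q =>
    p.eval q.1.length + (2 * q.1.length + 4) +
      (boolPair q.1 ((encodingList Bool).listBool.encode q.2)).length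
  have hT : ∀ (x : List Bool) (as : List (List Bool)),
      Tstep (x, as) ≤ (C₁ + 6) * (x.length + 1) ^ (C₁ + 6) *
        (((encodingList Bool).listBool.encode as).length + 1) := by
    intro x as
    have h1 : p.eval x.length + 4 * x.length + 6 ≤ (C₁ + 6) * (x.length + 1) ^ (C₁ + 6) := by
      have e1 := hp x.length
      have e2 : (x.length + 1) ≤ (x.length + 1) ^ C₁ := by
        simpa using Nat.pow_le_pow_right (Nat.succ_pos x.length) hC₁
      have e3 := mul_succ_pow_mono (show C₁ ≤ C₁ + 6 by omega) x.length
      have e4 : (x.length + 1) ^ C₁ ≤ (x.length + 1) ^ (C₁ + 6) :=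
        Nat.pow_le_pow_right (Nat.succ_pos _) (by omega)
      nlinarith
    have h2 : 1 ≤ (C₁ + 6) * (x.length + 1) ^ (C₁ + 6) := Nat.one_le_iff_ne_zero.2 (by positivity)
    have h3 : Tstep (x, as) = p.eval x.length + 4 * x.length + 6 +
        ((encodingList Bool).listBool.encode as).length := by
      simp only [Tstep, length_boolPair]; omega
    rw [h3]
    nlinarith
  refine ⟨karpAlg f, fun _ => 2, Tstep, max C (2 * C₂), ⟨2, fun x => ?_⟩,
    ⟨karpLift Mr, ?_⟩, ⟨C₁ + 6, fun x as => ?_⟩, fun x => ?_, fun x q hq => ?_⟩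
  · -- the round budget `2` is subexponential
    have h2 : (1 : ℝ) ≤ (2 : ℝ) ^ (ε * (Q₁.param x : ℝ)) :=
      Real.one_le_rpow one_le_two (by positivity)
    have h3 : (1 : ℝ) ≤ ((x.length : ℝ) + 1) ^ (2 : ℕ) :=
      one_le_pow₀ (by linarith [Nat.cast_nonneg (α := ℝ) x.length])
    calc (((fun _ : List Bool => (2 : ℕ)) x : ℕ) : ℝ) = 2 * 1 * 1 := by norm_num
      _ ≤ (2 : ℕ) * (2 : ℝ) ^ (ε * (Q₁.param x : ℝ)) * ((x.length : ℝ) + 1) ^ (2 : ℕ) := by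
        push_cast; gcongr
  · -- the step machine
    rintro ⟨x, _ | ⟨a, as⟩⟩
    · change (karpLift Mr).OutputsWithin (boolPair x ((encodingList Bool).listBool.encode []))
        (false :: f x) (Tstep (x, []))
      rw [listBool_encode_nil]
      refine (outputsWithin_karpLift_query Mr (hMr x)).mono ?_
      simp only [Tstep, id, listBool_encode_nil]
      omega
    · change (karpLift Mr).OutputsWithin (boolPair x ((encodingList Bool).listBool.encode (a :: as)))
        [true, a.headD false] (Tstep (x, a :: as))
      refine (outputsWithin_karpLift_answer Mr x a as).mono ?_
      simp only [Tstep]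
      omega
  · -- the step time is within the SERF bound (the factor `2^{ε p₁}` is not even used)
    have h1 : (Tstep (x, as) : ℝ) ≤ ((C₁ + 6 : ℕ) : ℝ) * ((x.length : ℝ) + 1) ^ (C₁ + 6) *
        ((((encodingList Bool).listBool.encode as).length : ℝ) + 1) := by
      exact_mod_cast hT x as
    refine h1.trans ?_
    have h2 : (1 : ℝ) ≤ (2 : ℝ) ^ (ε * (Q₁.param x : ℝ)) :=
      Real.one_le_rpow one_le_two (by positivity)
    calc ((C₁ + 6 : ℕ) : ℝ) * ((x.length : ℝ) + 1) ^ (C₁ + 6) *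
          ((((encodingList Bool).listBool.encode as).length : ℝ) + 1)
        = ((C₁ + 6 : ℕ) : ℝ) * 1 * ((x.length : ℝ) + 1) ^ (C₁ + 6) *
          ((((encodingList Bool).listBool.encode as).length : ℝ) + 1) := by ring
      _ ≤ ((C₁ + 6 : ℕ) : ℝ) * (2 : ℝ) ^ (ε * (Q₁.param x : ℝ)) *
          ((x.length : ℝ) + 1) ^ (C₁ + 6) *
          ((((encodingList Bool).listBool.encode as).length : ℝ) + 1) := by gcongr
  · -- the run: one query, the oracle's answer bit is the answer
    have hrun : (karpAlg f).run (Oracle.ofLanguage Q₂.lang) 2 x =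
        some (((Oracle.ofLanguage Q₂.lang) (f x)).headD false) :=
      run_karpAlg f _ 0 x
    rw [hrun, Oracle.ofLanguage_apply, Lemma3FP.encodeBool_eq, List.headD_cons]
    congr 1
    have hiff := hmem x
    rcases Bool.eq_false_or_eq_true (Q₁.lang.boolIndicator x) with h1 | h1
    · rw [h1]
      exact (Set.mem_iff_boolIndicator _ _).1 (hiff.1 ((Set.mem_iff_boolIndicator _ _).2 h1))
    · rw [h1]
      exact (Set.notMem_iff_boolIndicator _ _).1 fun h => (Set.notMem_iff_boolIndicator _ _).2 h1 (hiff.2 h)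
  · -- the query: parameter `≤ C · p₁(x)`, length polynomial
    have hq' : q = f x := by
      have hqs : (karpAlg f).queries (Oracle.ofLanguage Q₂.lang) 2 x = [f x] :=
        queries_karpAlg f _ 0 x
      rw [hqs, List.mem_singleton] at hq
      exact hq
    subst hq'
    refine ⟨(hpar x).trans (Nat.mul_le_mul_right _ (le_max_left _ _)), ?_⟩
    refine (hs x).trans ((hsC x.length).trans ?_)
    refine le_trans ?_ (mul_succ_pow_mono (le_max_right C (2 * C₂)) x.length)
    exact (Nat.mul_le_mul_left _ (Nat.pow_le_pow_right (Nat.succ_pos _) (by omega))).trans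
      (Nat.mul_le_mul_right _ (by omega))

namespace KSatSNP

/-! ### The SNP formula of `k`-SAT (Impagliazzo–Paturi–Zane 2001, §3) -/

/-- Input arities of the SNP presentation of `k`-SAT: `2^k` relation symbols `R_s` of arity `k`, one
for each sign pattern `s ∈ {0,1}^k` (read as a number `s < 2^k`, bit `i` the sign of position `i`).
[cite: ImpagliazzoPaturiZaneJCSS2001, §3, proof of Thm. 3 (k-SAT ∈ SNP)] -/
def inAr (k : ℕ) : List ℕ := List.replicate (2 ^ k) k

/-- Witness arities: one unary relation `S` (the assignment). [cite: ImpagliazzoPaturiZaneJCSS2001, §3, proof of Thm. 3] -/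
def wAr : List ℕ := [1]

/-- There are `2^k` input symbols. [folklore] -/
@[simp] theorem length_inAr (k : ℕ) : (inAr k).length = 2 ^ k := List.length_replicate ..

/-- Every input symbol has arity `k`. [folklore] -/
@[simp] theorem get_inAr (k : ℕ) (i : Fin (inAr k).length) : (inAr k).get i = k := by
  simp [inAr]

/-- Every input symbol has arity `k` (indexing form). [folklore] -/
@[simp] theorem getElem_inAr (k i : ℕ) (h : i < (inAr k).length) : (inAr k)[i] = k := by
  simp [inAr]

/-- The input relation symbol `R_s` of the sign pattern `s`. [cite: ImpagliazzoPaturiZaneJCSS2001, §3] -/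
def rsym (k : ℕ) (s : Fin (2 ^ k)) : (relLanguage (inAr k)).Relations k :=
  ⟨⟨s, by rw [length_inAr]; exact s.2⟩, get_inAr k _⟩

/-- The witness relation symbol `S`. [cite: ImpagliazzoPaturiZaneJCSS2001, §3] -/
def wsym : (relLanguage wAr).Relations 1 := ⟨⟨0, by decide⟩, rfl⟩

/-- The joint vocabulary of inputs and witness. [folklore] -/
abbrev lang (k : ℕ) : FirstOrder.Language := (relLanguage (inAr k)).sum (relLanguage wAr)

open FirstOrder FirstOrder.Language in
/-- The atomic formula `S(x_i)` on the bound variables `x_0, …, x_{k-1}`. [cite: ImpagliazzoPaturiZaneJCSS2001, §3] -/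
def witBF (k : ℕ) (i : Fin k) : (lang k).BoundedFormula Empty k :=
  Relations.boundedFormula (Sum.inr wsym : (lang k).Relations 1) ![Term.var (Sum.inr i)]

open FirstOrder FirstOrder.Language in
/-- The literal formula of position `i` under the sign pattern `s`: `S(x_i)` if bit `i` of `s` is set,
`¬ S(x_i)` otherwise. [cite: ImpagliazzoPaturiZaneJCSS2001, §3] -/
def litBF (k : ℕ) (s : Fin (2 ^ k)) (i : Fin k) : (lang k).BoundedFormula Empty k :=
  if (s : ℕ).testBit i then witBF k i else (witBF k i).not

open FirstOrder FirstOrder.Language in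
/-- The clause formula of the sign pattern `s`: `R_s(x_0, …, x_{k-1}) → ⋁_i lit_{s,i}`.
[cite: ImpagliazzoPaturiZaneJCSS2001, §3] -/
noncomputable def clauseBF (k : ℕ) (s : Fin (2 ^ k)) : (lang k).BoundedFormula Empty k :=
  (Relations.boundedFormula (Sum.inl (rsym k s) : (lang k).Relations k) fun i => Term.var (Sum.inr i)).imp
    (BoundedFormula.iSup (litBF k s))

open FirstOrder FirstOrder.Language in
/-- The quantifier-free matrix: the conjunction of the clause formulas over all sign patterns.
[cite: ImpagliazzoPaturiZaneJCSS2001, §3] -/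
noncomputable def matrixBF (k : ℕ) : (lang k).BoundedFormula Empty k :=
  BoundedFormula.iInf (clauseBF k)

open FirstOrder FirstOrder.Language in
/-- The universal sentence `∀ x_0 … x_{k-1} ⋀_s (R_s(x̄) → ⋁_i ± S(x_i))`. [cite: ImpagliazzoPaturiZaneJCSS2001, §3] -/
noncomputable def sentence (k : ℕ) : (lang k).Sentence := (matrixBF k).alls

open FirstOrder FirstOrder.Language in
/-- A `foldr` of `⊔` over quantifier-free formulas is quantifier-free. [folklore] -/
theorem isQF_foldr_sup {L : Language} {α : Type} {n : ℕ} {l : List (L.BoundedFormula α n)}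
    (h : ∀ φ ∈ l, φ.IsQF) : (l.foldr (· ⊔ ·) ⊥).IsQF := by
  induction l with
  | nil => exact BoundedFormula.isQF_bot
  | cons φ l ih =>
    rw [List.foldr_cons]
    exact (h φ (by simp)).sup (ih fun ψ hψ => h ψ (by simp [hψ]))

open FirstOrder FirstOrder.Language in
/-- A `foldr` of `⊓` over quantifier-free formulas is quantifier-free. [folklore] -/
theorem isQF_foldr_inf {L : Language} {α : Type} {n : ℕ} {l : List (L.BoundedFormula α n)}
    (h : ∀ φ ∈ l, φ.IsQF) : (l.foldr (· ⊓ ·) ⊤).IsQF := by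
  induction l with
  | nil => exact BoundedFormula.IsQF.top
  | cons φ l ih =>
    rw [List.foldr_cons]
    exact (h φ (by simp)).inf (ih fun ψ hψ => h ψ (by simp [hψ]))

open FirstOrder FirstOrder.Language in
/-- Finite disjunctions of quantifier-free formulas are quantifier-free. [folklore] -/
theorem isQF_iSup {L : Language} {α β : Type} [Finite β] {n : ℕ} {f : β → L.BoundedFormula α n}
    (h : ∀ b, (f b).IsQF) : (BoundedFormula.iSup f).IsQF := by
  unfold BoundedFormula.iSup
  exact isQF_foldr_sup fun φ hφ => by
    obtain ⟨b, -, rfl⟩ := List.mem_map.1 hφ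
    exact h b

open FirstOrder FirstOrder.Language in
/-- Finite conjunctions of quantifier-free formulas are quantifier-free. [folklore] -/
theorem isQF_iInf {L : Language} {α β : Type} [Finite β] {n : ℕ} {f : β → L.BoundedFormula α n}
    (h : ∀ b, (f b).IsQF) : (BoundedFormula.iInf f).IsQF := by
  unfold BoundedFormula.iInf
  exact isQF_foldr_inf fun φ hφ => by
    obtain ⟨b, -, rfl⟩ := List.mem_map.1 hφ
    exact h b

open FirstOrder FirstOrder.Language in
/-- Closing a universal formula under `alls` keeps it universal. [folklore] -/
theorem isUniversal_alls {L : Language} {α : Type} :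
    ∀ {n : ℕ} {φ : L.BoundedFormula α n}, φ.IsUniversal → φ.alls.IsUniversal
  | 0, _, h => h
  | _ + 1, φ, h => show φ.all.alls.IsUniversal from isUniversal_alls h.all

open FirstOrder FirstOrder.Language in
/-- The matrix is quantifier-free. [cite: ImpagliazzoPaturiZaneJCSS2001, §3] -/
theorem isQF_matrixBF (k : ℕ) : (matrixBF k).IsQF := by
  refine isQF_iInf fun s => ?_
  refine (BoundedFormula.IsAtomic.rel _ _).isQF.imp (isQF_iSup fun i => ?_)
  unfold litBF witBF
  split_ifs
  · exact (BoundedFormula.IsAtomic.rel _ _).isQF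
  · exact (BoundedFormula.IsAtomic.rel _ _).isQF.not

open FirstOrder FirstOrder.Language in
/-- The sentence is universal. [cite: ImpagliazzoPaturiZaneJCSS2001, §3] -/
theorem isUniversal_sentence (k : ℕ) : (sentence k).IsUniversal :=
  isUniversal_alls (isQF_matrixBF k).isUniversal

/-- **The SNP formula of `k`-SAT** (Impagliazzo–Paturi–Zane): inputs `R_s` (`s < 2^k`, arity `k`),
witness `S` (unary), sentence `∀ x̄ ⋀_s (R_s(x̄) → ⋁_i (S(x_i) ↔ s_i))`; its IPZ parameter on a universe
of size `n` is `n`. [cite: ImpagliazzoPaturiZaneJCSS2001, §3, proof of Thm. 3 (k-SAT ∈ SNP)] -/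
noncomputable def formula (k : ℕ) : SNPFormula where
  inputArities := inAr k
  witnessArities := wAr
  sentence := sentence k
  isUniversal := isUniversal_sentence k

/-- The witness parameter of the formula on a universe of size `n` is `n`. [cite: ImpagliazzoPaturiZaneJCSS2001, §3] -/
@[simp] theorem witnessBits_formula (k n : ℕ) : (formula k).witnessBits n = n := by
  simp [SNPFormula.witnessBits, formula, wAr]

/-! ### Semantics on tables -/

/-- The input table of the sign pattern `s` read on a `k`-tuple. [folklore] -/
def tab {k n : ℕ} (R : RelTables (inAr k) n) (s : Fin (2 ^ k)) (xs : Fin k → Fin n) : Bool :=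
  R ⟨s, by rw [length_inAr]; exact s.2⟩ (xs ∘ Fin.cast (get_inAr k _))

/-- The witness table read at a point. [folklore] -/
def wit {n : ℕ} (W : RelTables wAr n) (x : Fin n) : Bool := W ⟨0, by decide⟩ fun _ => x

/-- Unfolding the relations of `structureOfTables`. [folklore] -/
theorem relMap_structureOfTables {ar : List ℕ} {n m : ℕ} (R : RelTables ar n)
    (r : (relLanguage ar).Relations m) (v : Fin m → Fin n) :
    (structureOfTables R).RelMap r v ↔ R r.1 (v ∘ Fin.cast r.2) = true := Iff.rfl

open FirstOrder FirstOrder.Language in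
/-- **Semantics of the sentence on tables**: in the joint structure of input tables `R` and witness
table `W` on `Fin n`, the sentence holds iff every `k`-tuple `x̄` in `R_s` has a position `i` with
`S(x_i) = s_i`. [cite: ImpagliazzoPaturiZaneJCSS2001, §3] -/
theorem realize_sentence_iff (k n : ℕ) (R : RelTables (inAr k) n) (W : RelTables wAr n) :
    @Sentence.Realize _ (Fin n) (@sumStructure _ _ (Fin n) (structureOfTables R) (structureOfTables W))
        (sentence k) ↔
      ∀ (xs : Fin k → Fin n) (s : Fin (2 ^ k)), tab R s xs = true →
        ∃ i : Fin k, wit W (xs i) = (s : ℕ).testBit i := by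
  letI := structureOfTables R
  letI := structureOfTables W
  unfold sentence Sentence.Realize
  rw [BoundedFormula.realize_alls]
  refine forall_congr' fun xs => ?_
  unfold matrixBF
  rw [BoundedFormula.realize_iInf]
  refine forall_congr' fun s => ?_
  unfold clauseBF
  rw [BoundedFormula.realize_imp, BoundedFormula.realize_rel, BoundedFormula.realize_iSup]
  have hw : ∀ i : Fin k, (witBF k i).Realize (default : Empty → Fin n) xs ↔ wit W (xs i) = true := by
    intro i
    unfold witBF
    rw [BoundedFormula.realize_rel, relMap_sumInr, relMap_structureOfTables]
    refine iff_of_eq (congrArg (fun v => W _ v = true) (funext fun j => ?_))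
    simp only [Function.comp_apply, Matrix.cons_val_fin_one, Term.realize_var, Sum.elim_inr]
  refine imp_congr ?_ (exists_congr fun i => ?_)
  · rw [relMap_sumInl, relMap_structureOfTables]
    rfl
  · unfold litBF
    split_ifs with hb
    · rw [hw, hb]
    · rw [BoundedFormula.realize_not, hw]
      simp [hb]

/-- **The SNP formula holds on input tables `R` iff some assignment `σ : Fin n → Bool` gives every
tuple `x̄ ∈ R_s` a position `i` with `σ(x_i) = s_i`.** [cite: ImpagliazzoPaturiZaneJCSS2001, §3] -/
theorem holdsOnTables_iff (k n : ℕ) (R : RelTables (inAr k) n) :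
    (formula k).HoldsOnTables n R ↔
      ∃ σ : Fin n → Bool, ∀ (xs : Fin k → Fin n) (s : Fin (2 ^ k)), tab R s xs = true →
        ∃ i : Fin k, σ (xs i) = (s : ℕ).testBit i := by
  rw [SNPFormula.holdsOnTables_iff]
  change (∃ W : RelTables wAr n, @FirstOrder.Language.Sentence.Realize _ (Fin n)
    (@FirstOrder.Language.sumStructure _ _ (Fin n) (structureOfTables R) (structureOfTables W)) (sentence k)) ↔ _
  constructor
  · rintro ⟨W, hW⟩
    exact ⟨wit W, (realize_sentence_iff k n R W).1 hW⟩
  · rintro ⟨σ, hσ⟩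
    refine ⟨fun _ v => σ (v ⟨0, by simp [wAr]⟩), (realize_sentence_iff k n R _).2 ?_⟩
    intro xs s h
    obtain ⟨i, hi⟩ := hσ xs s h
    exact ⟨i, by simpa [wit] using hi⟩

/-! ### Positions in the table string of an instance -/

/-- **The table string of an instance, bit by bit**: the bit at position `idx` is the bit of table
`i` at the tuple numbered `t`, where `⟨i, t⟩ = finSigmaFinEquiv⁻¹ idx` and tuples are numbered by
`finFunctionFinEquiv` (definitional unfolding of `relTablesEquiv`).
[cite: ImpagliazzoPaturiZane2001, §3 (an `n`-element structure with a `k`-ary relation takes `n^k` bits)] -/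
theorem relTablesEquiv_apply {ar : List ℕ} {n : ℕ} (R : RelTables ar n) (idx : Fin (tableBits ar n)) :
    relTablesEquiv ar n R idx =
      R (finSigmaFinEquiv.symm idx).1 (finFunctionFinEquiv.symm (finSigmaFinEquiv.symm idx).2) := rfl

/-- The table string at the position of `⟨i, t⟩`. [cite: ImpagliazzoPaturiZane2001, §3] -/
theorem relTablesEquiv_apply_finSigmaFinEquiv {ar : List ℕ} {n : ℕ} (R : RelTables ar n)
    (p : Σ i : Fin ar.length, Fin (n ^ ar.get i)) :
    relTablesEquiv ar n R (finSigmaFinEquiv p) = R p.1 (finFunctionFinEquiv.symm p.2) := by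
  rw [relTablesEquiv_apply]
  have key : ∀ q : Σ i : Fin ar.length, Fin (n ^ ar.get i), q = p →
      R q.1 (finFunctionFinEquiv.symm q.2) = R p.1 (finFunctionFinEquiv.symm p.2) := by
    rintro q rfl; rfl
  exact key _ (Equiv.symm_apply_apply _ _)

/-- The number of table bits of the `k`-SAT signature on a universe of size `n` is `2^k · n^k`. [folklore] -/
@[simp] theorem tableBits_inAr (k n : ℕ) : tableBits (inAr k) n = 2 ^ k * n ^ k := by
  simp [tableBits]

/-- Position of `⟨s, t⟩` in the table string of the `k`-SAT signature: `s · n^k + t`. [folklore] -/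
theorem val_finSigmaFinEquiv_inAr (k n : ℕ) (p : Σ i : Fin (inAr k).length, Fin (n ^ (inAr k).get i)) :
    (finSigmaFinEquiv p : ℕ) = p.1 * n ^ k + p.2 := by
  rw [finSigmaFinEquiv_apply]
  simp

/-- A tuple number below `n^k` with `k ≥ 1` forces `n ≥ 1`. [folklore] -/
theorem pos_of_lt_pow {n k t : ℕ} (ht : t < n ^ k) (i : Fin k) : 0 < n := by
  rcases Nat.eq_zero_or_pos n with rfl | h
  · rw [zero_pow (Nat.ne_of_gt (Fin.pos i))] at ht
    exact absurd ht (Nat.not_lt_zero _)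
  · exact h

/-- The `k`-tuple numbered `t < n^k`: digit `i` of `t` in base `n` (the inverse of `finFunctionFinEquiv`).
[folklore] -/
def tupleOf {k n t : ℕ} (ht : t < n ^ k) : Fin k → Fin n :=
  fun i => ⟨t / n ^ (i : ℕ) % n, Nat.mod_lt _ (pos_of_lt_pow ht i)⟩

/-- `tupleOf` is `finFunctionFinEquiv.symm` (values). [folklore] -/
@[simp] theorem val_tupleOf {k n t : ℕ} (ht : t < n ^ k) (i : Fin k) : (tupleOf ht i : ℕ) = t / n ^ (i : ℕ) % n := rfl

/-- **The input tables read at a numeric position**: sign pattern `s < 2^k` and tuple number `t < n^k`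
(`false` off range). [folklore] -/
def ntab {k n : ℕ} (R : RelTables (inAr k) n) (s t : ℕ) : Bool :=
  if h : s < 2 ^ k ∧ t < n ^ k then tab R ⟨s, h.1⟩ (tupleOf h.2) else false

/-- `ntab` in range. [folklore] -/
theorem ntab_of_lt {k n : ℕ} (R : RelTables (inAr k) n) {s t : ℕ} (hs : s < 2 ^ k) (ht : t < n ^ k) :
    ntab R s t = tab R ⟨s, hs⟩ (tupleOf ht) := by
  rw [ntab, dif_pos ⟨hs, ht⟩]

/-- **Layout of the table string**: bit `j` of the code of the tables `R` is the table of the sign pattern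
`j / n^k` at the tuple numbered `j % n^k`. [cite: ImpagliazzoPaturiZane2001, §3] -/
theorem getD_ofFn_relTablesEquiv {k n : ℕ} (R : RelTables (inAr k) n) (j : ℕ) :
    (List.ofFn (relTablesEquiv (inAr k) n R)).getD j false = ntab R (j / n ^ k) (j % n ^ k) := by
  by_cases hj : j < 2 ^ k * n ^ k
  · have hN : 0 < n ^ k := Nat.pos_of_ne_zero fun h0 => by rw [h0, mul_zero] at hj; exact Nat.not_lt_zero _ hj
    have hs : j / n ^ k < 2 ^ k := Nat.div_lt_of_lt_mul (by rwa [mul_comm] at hj)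
    have ht : j % n ^ k < n ^ k := Nat.mod_lt _ hN
    let p : Σ i : Fin (inAr k).length, Fin (n ^ (inAr k).get i) :=
      ⟨⟨j / n ^ k, by rw [length_inAr]; exact hs⟩, ⟨j % n ^ k, by rw [get_inAr]; exact ht⟩⟩
    have hp : (finSigmaFinEquiv p : ℕ) = j := by
      rw [val_finSigmaFinEquiv_inAr]; exact Nat.div_add_mod' j (n ^ k)
    have hlen : j < (List.ofFn (relTablesEquiv (inAr k) n R)).length := by
      rw [List.length_ofFn, tableBits_inAr]; exact hj
    rw [List.getD_eq_getElem _ _ hlen, List.getElem_ofFn, ntab_of_lt R hs ht]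
    have hidx : (⟨j, by rw [tableBits_inAr]; exact hj⟩ : Fin (tableBits (inAr k) n)) = finSigmaFinEquiv p :=
      Fin.ext hp.symm
    rw [hidx, relTablesEquiv_apply_finSigmaFinEquiv]
    unfold tab
    congr 1
  · rw [List.getD_eq_default _ _ (by rw [List.length_ofFn, tableBits_inAr]; exact Nat.not_lt.1 hj), ntab,
      dif_neg]
    rintro ⟨hs, ht⟩
    have hN : 0 < n ^ k := Nat.pos_of_ne_zero fun h0 => by rw [h0] at ht; exact Nat.not_lt_zero _ ht
    exact hj ((Nat.div_lt_iff_lt_mul hN).1 hs)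

/-- Every `k`-tuple is the tuple of its number. [folklore] -/
theorem tupleOf_finFunctionFinEquiv {k n : ℕ} (xs : Fin k → Fin n) :
    tupleOf (finFunctionFinEquiv xs).2 = xs := by
  have h := finFunctionFinEquiv.symm_apply_apply xs
  funext i
  apply Fin.ext
  rw [val_tupleOf, ← h]
  simp only [finFunctionFinEquiv_symm_apply_val]
  rw [h]


/-! ### Clauses read off table positions -/

/-- **The clause of the sign pattern `s` on the tuple numbered `t`**: position `i < k` carries the
variable `t / n^i % n` (digit `i` of `t` in base `n`) with the sign bit `i` of `s`.
[cite: ImpagliazzoPaturiZaneJCSS2001, §3 (R_s(x̄) ↔ the clause with variables x̄ and signs s is present)] -/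
def clauseOf (k n s t : ℕ) : Clause ℕ := List.ofFn fun i : Fin k => (t / n ^ (i : ℕ) % n, s.testBit i)

/-- `clauseOf` has width `k`. [folklore] -/
@[simp] theorem length_clauseOf (k n s t : ℕ) : (clauseOf k n s t).length = k := List.length_ofFn ..

/-- Evaluation of `clauseOf`: some position `i` has `σ(t / n^i % n) = s_i`. [folklore] -/
theorem eval_clauseOf (σ : ℕ → Bool) (k n s t : ℕ) :
    Clause.eval σ (clauseOf k n s t) = true ↔ ∃ i : Fin k, σ (t / n ^ (i : ℕ) % n) = s.testBit i := by
  simp only [Clause.eval, clauseOf, List.any_eq_true, List.mem_ofFn, Literal.eval, beq_iff_eq]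
  constructor
  · rintro ⟨l, ⟨i, rfl⟩, h⟩; exact ⟨i, h⟩
  · rintro ⟨i, h⟩; exact ⟨_, ⟨i, rfl⟩, h⟩

/-- The variables of `clauseOf k n s t` are `< n` as soon as `t < n^k`. [folklore] -/
theorem fst_lt_of_mem_clauseOf {k n s t : ℕ} (ht : t < n ^ k) {l : Literal ℕ} (hl : l ∈ clauseOf k n s t) :
    l.1 < n := by
  obtain ⟨i, rfl⟩ := List.mem_ofFn.1 hl
  exact Nat.mod_lt _ (pos_of_lt_pow ht i)

/-! ### The formula on tables, numerically -/

/-- **The SNP formula on tables, in numeric form**: it holds iff some assignment `σ : ℕ → Bool` satisfies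
the clause `clauseOf k n s t` of every set table bit `(s, t)`. [cite: ImpagliazzoPaturiZaneJCSS2001, §3] -/
theorem holdsOnTables_iff_ntab (k n : ℕ) (R : RelTables (inAr k) n) :
    (formula k).HoldsOnTables n R ↔
      ∃ σ : ℕ → Bool, ∀ s t : ℕ, ntab R s t = true → Clause.eval σ (clauseOf k n s t) = true := by
  rw [holdsOnTables_iff]
  constructor
  · rintro ⟨σ, hσ⟩
    refine ⟨fun v => if h : v < n then σ ⟨v, h⟩ else false, fun s t hst => ?_⟩
    by_cases h : s < 2 ^ k ∧ t < n ^ k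
    · rw [ntab, dif_pos h] at hst
      obtain ⟨i, hi⟩ := hσ (tupleOf h.2) ⟨s, h.1⟩ hst
      rw [eval_clauseOf]
      refine ⟨i, ?_⟩
      rw [dif_pos (Nat.mod_lt _ (pos_of_lt_pow h.2 i))]
      exact hi
    · rw [ntab, dif_neg h] at hst
      exact absurd hst Bool.false_ne_true
  · rintro ⟨σ, hσ⟩
    refine ⟨fun x => σ x, fun xs s hxs => ?_⟩
    have ht := (finFunctionFinEquiv xs).2
    have hn : ntab R s (finFunctionFinEquiv xs) = true := by
      rw [ntab_of_lt R s.2 ht, tupleOf_finFunctionFinEquiv]; exact hxs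
    obtain ⟨i, hi⟩ := (eval_clauseOf _ _ _ _ _).1 (hσ _ _ hn)
    refine ⟨i, ?_⟩
    have hx : (xs i : ℕ) = finFunctionFinEquiv xs / n ^ (i : ℕ) % n := by
      rw [← val_tupleOf ht i, tupleOf_finFunctionFinEquiv]
    show σ (xs i) = _
    rw [hx]
    exact hi

/-! ### From tables to a `k`-CNF -/

/-- **The `k`-CNF of a table string**: one clause `clauseOf k n (j / n^k) (j % n^k)` for every set bit `j`.
[cite: ImpagliazzoPaturiZaneJCSS2001, §3] -/
def cnfOfBits (k n : ℕ) (bits : List Bool) : CNF ℕ :=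
  ((List.range bits.length).filter fun j => bits.getD j false).map fun j => clauseOf k n (j / n ^ k) (j % n ^ k)

/-- Membership in `cnfOfBits`. [folklore] -/
theorem mem_cnfOfBits_iff {k n : ℕ} {bits : List Bool} {c : Clause ℕ} :
    c ∈ cnfOfBits k n bits ↔ ∃ j, bits.getD j false = true ∧ clauseOf k n (j / n ^ k) (j % n ^ k) = c := by
  simp only [cnfOfBits, List.mem_map, List.mem_filter, List.mem_range]
  constructor
  · rintro ⟨j, ⟨-, hj⟩, rfl⟩; exact ⟨j, hj, rfl⟩
  · rintro ⟨j, hj, rfl⟩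
    refine ⟨j, ⟨?_, hj⟩, rfl⟩
    by_contra hlt
    rw [List.getD_eq_default _ _ (Nat.not_lt.1 hlt)] at hj
    exact Bool.false_ne_true hj

/-- `cnfOfBits` is a `k`-CNF. [folklore] -/
theorem isWidthLE_cnfOfBits (k n : ℕ) (bits : List Bool) : (cnfOfBits k n bits).IsWidthLE k := by
  intro c hc
  obtain ⟨j, -, rfl⟩ := mem_cnfOfBits_iff.1 hc
  rw [length_clauseOf]

/-- The number of clauses of `cnfOfBits` is at most the number of bits. [folklore] -/
theorem length_cnfOfBits_le (k n : ℕ) (bits : List Bool) : (cnfOfBits k n bits).length ≤ bits.length := by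
  rw [cnfOfBits, List.length_map]
  exact (List.length_filter_le _ _).trans (by rw [List.length_range])

/-- The variables of `cnfOfBits` are `< n` when the string is not longer than a table string. [folklore] -/
theorem numVars_cnfOfBits_le {k n : ℕ} {bits : List Bool} (hlen : bits.length ≤ 2 ^ k * n ^ k) :
    (cnfOfBits k n bits).numVars ≤ n := by
  rw [SerfRename.numVars_le_iff]
  intro l hl
  obtain ⟨c, hc, hlc⟩ := List.mem_flatten.1 hl
  obtain ⟨j, hj, rfl⟩ := mem_cnfOfBits_iff.1 hc
  have hjl : j < bits.length := by
    by_contra hlt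
    rw [List.getD_eq_default _ _ (Nat.not_lt.1 hlt)] at hj
    exact Bool.false_ne_true hj
  have hN : 0 < n ^ k := Nat.pos_of_ne_zero fun h0 => by
    rw [h0, mul_zero] at hlen; omega
  exact fst_lt_of_mem_clauseOf (Nat.mod_lt _ hN) hlc

/-- **The `k`-CNF of the table string of `R` is satisfiable iff the SNP formula holds on `R`.**
[cite: ImpagliazzoPaturiZaneJCSS2001, §3] -/
theorem satisfiable_cnfOfBits_iff {k n : ℕ} (R : RelTables (inAr k) n) :
    (cnfOfBits k n (List.ofFn (relTablesEquiv (inAr k) n R))).Satisfiable ↔ (formula k).HoldsOnTables n R := by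
  rw [holdsOnTables_iff_ntab]
  refine exists_congr fun σ => ?_
  rw [CNF.eval_eq_true_iff]
  constructor
  · intro h s t hst
    obtain ⟨hs, ht⟩ : s < 2 ^ k ∧ t < n ^ k := by
      by_contra hno; rw [ntab, dif_neg hno] at hst; exact Bool.false_ne_true hst
    have hN : 0 < n ^ k := lt_of_le_of_lt (Nat.zero_le _) ht
    have hdiv : (s * n ^ k + t) / n ^ k = s := by
      rw [Nat.add_comm, Nat.add_mul_div_right _ _ hN, Nat.div_eq_of_lt ht, Nat.zero_add]
    have hmod : (s * n ^ k + t) % n ^ k = t := by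
      rw [Nat.add_comm, Nat.add_mul_mod_self_right, Nat.mod_eq_of_lt ht]
    apply h
    rw [mem_cnfOfBits_iff]
    refine ⟨s * n ^ k + t, ?_, ?_⟩
    · rw [getD_ofFn_relTablesEquiv, hdiv, hmod]; exact hst
    · rw [hdiv, hmod]
  · intro h c hc
    obtain ⟨j, hj, rfl⟩ := mem_cnfOfBits_iff.1 hc
    rw [getD_ofFn_relTablesEquiv] at hj
    exact h _ _ hj

/-! ### From a clause set to tables -/

/-- **The input tables of a clause set `ψ`** on the universe `Fin n`: `R_s(v̄)` holds iff the clause with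
variables `v̄` and signs `s` belongs to `ψ`. [cite: ImpagliazzoPaturiZaneJCSS2001, §3] -/
def relOfCNF (k n : ℕ) (ψ : CNF ℕ) : RelTables (inAr k) n :=
  fun i v => decide (List.ofFn (fun j : Fin ((inAr k).get i) => ((v j : ℕ), (i : ℕ).testBit j)) ∈ ψ)

/-- The tables of `ψ` at a numeric position. [folklore] -/
theorem ntab_relOfCNF (k n : ℕ) (ψ : CNF ℕ) (s t : ℕ) :
    ntab (relOfCNF k n ψ) s t = decide (s < 2 ^ k ∧ t < n ^ k ∧ clauseOf k n s t ∈ ψ) := by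
  by_cases h : s < 2 ^ k ∧ t < n ^ k
  · rw [ntab, dif_pos h]
    unfold tab relOfCNF
    have hl : List.ofFn (fun j : Fin ((inAr k).get ⟨s, by rw [length_inAr]; exact h.1⟩) =>
        (((tupleOf h.2 ∘ Fin.cast (get_inAr k _)) j : ℕ),
          ((⟨s, by rw [length_inAr]; exact h.1⟩ : Fin (inAr k).length) : ℕ).testBit j)) = clauseOf k n s t := by
      rw [List.ofFn_congr (get_inAr k _), clauseOf]
      rfl
    rw [hl]
    simp [h.1, h.2]
  · rw [ntab, dif_neg h]
    symm
    rw [decide_eq_false_iff_not]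
    exact fun h' => h ⟨h'.1, h'.2.1⟩

/-- **The table string of a clause set**, bit by bit. [cite: ImpagliazzoPaturiZaneJCSS2001, §3] -/
def bitsOfCNF (k n : ℕ) (ψ : CNF ℕ) : List Bool :=
  (List.range (2 ^ k * n ^ k)).map fun j => decide (clauseOf k n (j / n ^ k) (j % n ^ k) ∈ ψ)

/-- Length of the table string of a clause set. [folklore] -/
@[simp] theorem length_bitsOfCNF (k n : ℕ) (ψ : CNF ℕ) : (bitsOfCNF k n ψ).length = 2 ^ k * n ^ k := by
  simp [bitsOfCNF]

/-- **The code of the tables of `ψ` is `bitsOfCNF`.** [cite: ImpagliazzoPaturiZaneJCSS2001, §3] -/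
theorem ofFn_relTablesEquiv_relOfCNF (k n : ℕ) (ψ : CNF ℕ) :
    List.ofFn (relTablesEquiv (inAr k) n (relOfCNF k n ψ)) = bitsOfCNF k n ψ := by
  apply List.ext_getElem
  · rw [List.length_ofFn, tableBits_inAr, length_bitsOfCNF]
  · intro j h1 h2
    have h := getD_ofFn_relTablesEquiv (relOfCNF k n ψ) j
    rw [List.getD_eq_getElem _ _ h1, ntab_relOfCNF] at h
    rw [h]
    rw [length_bitsOfCNF] at h2
    have hN : 0 < n ^ k := Nat.pos_of_ne_zero fun h0 => by rw [h0, mul_zero] at h2; exact Nat.not_lt_zero _ h2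
    have hs : j / n ^ k < 2 ^ k := Nat.div_lt_of_lt_mul (by rwa [mul_comm] at h2)
    have ht : j % n ^ k < n ^ k := Nat.mod_lt _ hN
    simp [bitsOfCNF, hs, ht]

/-- A clause of width `k` with variables below `n` is the clause of a table position. [folklore] -/
theorem exists_eq_clauseOf {k n : ℕ} {c : Clause ℕ} (hlen : c.length = k) (hvar : ∀ l ∈ c, l.1 < n) :
    ∃ s t : ℕ, s < 2 ^ k ∧ t < n ^ k ∧ clauseOf k n s t = c := by
  subst hlen
  let v : Fin c.length → Fin n := fun i => ⟨(c.get i).1, hvar _ (List.get_mem c i)⟩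
  let b : Fin c.length → Fin 2 := fun i => if (c.get i).2 then 1 else 0
  refine ⟨finFunctionFinEquiv b, finFunctionFinEquiv v, (finFunctionFinEquiv b).2, (finFunctionFinEquiv v).2, ?_⟩
  have hv : ∀ i : Fin c.length, (finFunctionFinEquiv v : ℕ) / n ^ (i : ℕ) % n = (c.get i).1 := fun i => by
    have h := congrFun (finFunctionFinEquiv.symm_apply_apply v) i
    have h' := congrArg Fin.val h
    rw [finFunctionFinEquiv_symm_apply_val] at h'
    exact h'
  have hb : ∀ i : Fin c.length, (finFunctionFinEquiv b : ℕ).testBit i = (c.get i).2 := fun i => by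
    have h := congrFun (finFunctionFinEquiv.symm_apply_apply b) i
    have h' := congrArg Fin.val h
    rw [finFunctionFinEquiv_symm_apply_val] at h'
    rw [Nat.testBit_eq_decide_div_mod_eq, h']
    simp only [b]
    split_ifs with hc2 <;> simpa using hc2
  conv_rhs => rw [← List.ofFn_get c]
  unfold clauseOf
  congr 1
  funext i
  rw [hv, hb]

/-- **The SNP formula holds on the tables of a width-`k` clause set with variables below `n` iff the
clause set is satisfiable.** [cite: ImpagliazzoPaturiZaneJCSS2001, §3] -/
theorem holdsOnTables_relOfCNF_iff {k n : ℕ} {ψ : CNF ℕ} (hlen : ∀ c ∈ ψ, c.length = k)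
    (hvar : ∀ c ∈ ψ, ∀ l ∈ c, l.1 < n) :
    (formula k).HoldsOnTables n (relOfCNF k n ψ) ↔ ψ.Satisfiable := by
  rw [holdsOnTables_iff_ntab]
  refine exists_congr fun σ => ?_
  rw [CNF.eval_eq_true_iff]
  constructor
  · intro h c hc
    obtain ⟨s, t, hs, ht, rfl⟩ := exists_eq_clauseOf (hlen c hc) (hvar c hc)
    exact h s t (by rw [ntab_relOfCNF]; simp [hs, ht, hc])
  · intro h s t hst
    rw [ntab_relOfCNF, decide_eq_true_eq] at hst
    exact h _ hst.2.2

/-! ### Forward preprocessing: renaming into an initial segment and padding to width `k` -/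

/-- Padding a clause to width `k` by copies of its first literal. [folklore] -/
def padClause (k : ℕ) (c : Clause ℕ) : Clause ℕ := c ++ List.replicate (k - c.length) (c.headD (0, false))

/-- A padded clause of width `≤ k` has width `k`. [folklore] -/
theorem length_padClause {k : ℕ} {c : Clause ℕ} (h : c.length ≤ k) : (padClause k c).length = k := by
  rw [padClause, List.length_append, List.length_replicate]; omega

/-- The literals of a padded non-empty clause are literals of the clause. [folklore] -/
theorem mem_of_mem_padClause {k : ℕ} {c : Clause ℕ} (hc : c ≠ []) {l : Literal ℕ} (hl : l ∈ padClause k c) :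
    l ∈ c := by
  rcases List.mem_append.1 hl with h | h
  · exact h
  · rw [List.mem_replicate] at h
    rw [h.2]
    cases c with
    | nil => exact absurd rfl hc
    | cons a c => exact List.mem_cons_self ..

/-- Padding a non-empty clause does not change its value. [folklore] -/
theorem eval_padClause {k : ℕ} {c : Clause ℕ} (hc : c ≠ []) (σ : ℕ → Bool) :
    Clause.eval σ (padClause k c) = Clause.eval σ c := by
  rw [Bool.eq_iff_iff]
  simp only [Clause.eval, List.any_eq_true]
  constructor
  · rintro ⟨l, hl, h⟩; exact ⟨l, mem_of_mem_padClause hc hl, h⟩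
  · rintro ⟨l, hl, h⟩; exact ⟨l, List.mem_append_left _ hl, h⟩

/-- **The new number of variables** `n' = min (numVars φ) (size φ)` (the universe size of the instance).
[cite: ImpagliazzoPaturiZaneJCSS2001, §3] -/
def newNumVars (φ : CNF ℕ) : ℕ := min φ.numVars φ.size

/-- **The renaming**: the identity if `numVars φ ≤ size φ`, else the occurrence rank of `SerfRename`
(both are injective on the occurring variables and map them below `newNumVars φ`). [folklore] -/
def renum (φ : CNF ℕ) (v : ℕ) : ℕ := if φ.numVars ≤ φ.size then v else SerfRename.rank φ v

/-- Occurring variables are renamed below `newNumVars`. [folklore] -/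
theorem renum_lt {φ : CNF ℕ} {c : Clause ℕ} (hc : c ∈ φ) {l : Literal ℕ} (hl : l ∈ c) :
    renum φ l.1 < newNumVars φ := by
  unfold renum newNumVars
  split_ifs with h
  · rw [min_eq_left h]; exact CNF.lt_numVars_of_mem_of_mem hc hl
  · rw [min_eq_right (Nat.le_of_not_le h)]
    exact SerfRename.rank_lt_size φ (SerfRename.mem_occ hc hl)

/-- The renaming is injective on the occurring variables. [folklore] -/
theorem renum_injOn (φ : CNF ℕ) : Set.InjOn (renum φ) φ.vars := by
  intro v hv v' hv' h
  unfold renum at h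
  split_ifs at h with hc
  · exact h
  · unfold CNF.vars at hv hv'
    rw [Finset.mem_coe, List.mem_toFinset] at hv hv'
    exact SerfRename.rank_injOn φ hv hv' h

/-- `newNumVars φ ≤ numVars φ`. [folklore] -/
theorem newNumVars_le_numVars (φ : CNF ℕ) : newNumVars φ ≤ φ.numVars := min_le_left _ _

/-- `newNumVars φ ≤ size φ`. [folklore] -/
theorem newNumVars_le_size (φ : CNF ℕ) : newNumVars φ ≤ φ.size := min_le_right _ _

/-- **The preprocessed clause set**: rename, then pad every clause to width `k`. [folklore] -/
def prep (k : ℕ) (φ : CNF ℕ) : CNF ℕ := (φ.map fun c => c.map fun l => (renum φ l.1, l.2)).map (padClause k)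

/-- The renamed formula is `CNF.rename`. [folklore] -/
theorem map_renum_eq_rename (φ : CNF ℕ) :
    (φ.map fun c => c.map fun l => (renum φ l.1, l.2)) = φ.rename (renum φ) := rfl

/-- Clauses of the preprocessed set have width `k` (for a `k`-CNF without the empty clause). [folklore] -/
theorem length_of_mem_prep {k : ℕ} {φ : CNF ℕ} (hw : φ.IsWidthLE k) {c : Clause ℕ} (hc : c ∈ prep k φ) :
    c.length = k := by
  simp only [prep, List.map_map, List.mem_map, Function.comp_apply] at hc
  obtain ⟨c₀, hc₀, rfl⟩ := hc
  exact length_padClause (by rw [List.length_map]; exact hw c₀ hc₀)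

/-- Variables of the preprocessed set are below `newNumVars`. [folklore] -/
theorem fst_lt_of_mem_prep {k : ℕ} {φ : CNF ℕ} (hne : [] ∉ φ) {c : Clause ℕ} (hc : c ∈ prep k φ)
    {l : Literal ℕ} (hl : l ∈ c) : l.1 < newNumVars φ := by
  simp only [prep, List.map_map, List.mem_map, Function.comp_apply] at hc
  obtain ⟨c₀, hc₀, rfl⟩ := hc
  have hne₀ : c₀.map (fun l : Literal ℕ => (renum φ l.1, l.2)) ≠ [] := by
    intro h; rw [List.map_eq_nil_iff] at h; exact hne (h ▸ hc₀)
  obtain ⟨l₀, hl₀, rfl⟩ := List.mem_map.1 (mem_of_mem_padClause hne₀ hl)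
  exact renum_lt hc₀ hl₀

/-- **Preprocessing preserves satisfiability** (for a formula without the empty clause).
[cite: ImpagliazzoPaturiZaneJCSS2001, §3] -/
theorem satisfiable_prep_iff {k : ℕ} {φ : CNF ℕ} (hne : [] ∉ φ) : (prep k φ).Satisfiable ↔ φ.Satisfiable := by
  rw [← CNF.satisfiable_rename_iff φ (renum_injOn φ), ← map_renum_eq_rename]
  unfold prep CNF.Satisfiable
  refine exists_congr fun σ => ?_
  rw [CNF.eval_eq_true_iff, CNF.eval_eq_true_iff]
  constructor
  · intro h c hc
    have hcne : c ≠ [] := by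
      obtain ⟨c₀, hc₀, rfl⟩ := List.mem_map.1 hc
      intro h0; rw [List.map_eq_nil_iff] at h0; exact hne (h0 ▸ hc₀)
    rw [← eval_padClause hcne]
    exact h _ (List.mem_map.2 ⟨c, hc, rfl⟩)
  · intro h c hc
    obtain ⟨c₁, hc₁, rfl⟩ := List.mem_map.1 hc
    have hcne : c₁ ≠ [] := by
      obtain ⟨c₀, hc₀, rfl⟩ := List.mem_map.1 hc₁
      intro h0; rw [List.map_eq_nil_iff] at h0; exact hne (h0 ▸ hc₀)
    rw [eval_padClause hcne]
    exact h _ hc₁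

/-- **The instance of a `k`-CNF**: universe `Fin (newNumVars φ)`, tables of the preprocessed clause set.
[cite: ImpagliazzoPaturiZaneJCSS2001, §3] -/
def instOf (k : ℕ) (φ : CNF ℕ) : SNPInstance (inAr k) :=
  ⟨newNumVars φ, relOfCNF k (newNumVars φ) (prep k φ)⟩

/-- **Correctness of the forward map**: for a `k`-CNF without the empty clause, the SNP formula holds on
its instance iff the formula is satisfiable. [cite: ImpagliazzoPaturiZaneJCSS2001, §3] -/
theorem holdsOnTables_instOf_iff {k : ℕ} {φ : CNF ℕ} (hw : φ.IsWidthLE k) (hne : [] ∉ φ) :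
    (formula k).HoldsOnTables (instOf k φ).1 (instOf k φ).2 ↔ φ.Satisfiable := by
  unfold instOf
  rw [holdsOnTables_relOfCNF_iff (fun c hc => length_of_mem_prep hw hc) (fun c hc l hl => fst_lt_of_mem_prep hne hc hl),
    satisfiable_prep_iff hne]

/-! ### Codes (the `CodeFP` presentation of the tree's encodings)

The three encoder abbreviations and `cnfE_eq` are twins of `AOWProg.litE/clauseE/cnfE/cnfE_eq` of
`Complexity/AOWProgramFP.lean` (and of `SumcheckMA.cnfE_eq`), whose Allen–O'Donnell–Witmer / sum-check import
closures are not wanted in the fine-grained files; likewise `strFlatten` below is a twin of `TQBFRed.strJoin` of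
`Barriers/QuantumAdvantage/TQBFSavitchCode.lean` (a barrier file, not imported into `Literature/Computability`). -/

section Codes

open CodeFP Brick

/-- Literals are coded by `⟨binary variable, sign bit⟩`. [folklore] -/
abbrev litE : Literal ℕ → List Bool := pairE natE bitE

/-- Clauses: headed lists of literal codes. [folklore] -/
abbrev clauseE : Clause ℕ → List Bool := listE litE

/-- CNFs: headed lists of clause codes. [folklore] -/
abbrev cnfE : CNF ℕ → List Bool := listE clauseE

/-- `encodingLiteral` codes by `litE`. [folklore] -/
theorem litE_eq : (encodingLiteral.encode : Literal ℕ → List Bool) = litE := pairE_eq _ _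

/-- `encodingClause` codes by `clauseE`. [folklore] -/
theorem clauseE_eq : (encodingClause.encode : Clause ℕ → List Bool) = clauseE := by
  rw [encodingClause, listE_eq, litE_eq]

/-- `encodingCNF` codes by `cnfE` (twin of `AOWProg.cnfE_eq`, see the section note). [folklore] -/
theorem cnfE_eq : (encodingCNF.encode : CNF ℕ → List Bool) = cnfE := by
  rw [encodingCNF, listE_eq, clauseE_eq]

/-- Pointwise form of `cnfE_eq`. [folklore] -/
theorem encode_eq_cnfE (φ : CNF ℕ) : encodingCNF.encode φ = cnfE φ := congrFun cnfE_eq φ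

/-- `litE` is injective. [folklore] -/
theorem litE_injective : Function.Injective litE := pairE_injective natE_injective bitE_injective

/-- Strings code themselves injectively. [folklore] -/
theorem strE_injective : Function.Injective strE := fun _ _ h => h

/-! ### Small generic combinators -/

/-- **Bit access by a unary position**: `(1ⁱ, w) ↦ w[i]` (`false` past the end). [folklore] -/
theorem strGetD : CodeFP (pairE unE strE) bitE (fun p => p.2.getD p.1 false) :=
  ⟨HashBricks.headBitFn ∘ bitAtFn, comp_mem_FP HashBricks.headBitFn_mem_FP bitAtFn_mem_FP, fun p => by
    rw [pairE_apply, Function.comp_apply, bitAtFn_boolPair, HashBricks.headBitFn_apply, length_unE]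
    change [((p.2.drop p.1).take 1).headD false] = [p.2.getD p.1 false]
    rw [List.getD_eq_getElem?_getD, ← List.head?_drop]
    cases p.2.drop p.1 <;> rfl⟩

/-- **Bit access by a binary position**: `(w, i) ↦ w[i]` (`false` past the end). [folklore] -/
theorem strGetDNat : CodeFP (pairE strE natE) bitE (fun p => p.1.getD p.2 false) :=
  (strGetD.comp ((unOfNatMin.comp ((strLength.comp (fst strE natE)).pair (snd strE natE))).pair
    (fst strE natE))).congr fun p => by
      obtain ⟨w, i⟩ := p
      simp only
      by_cases h : i < w.length
      · rw [min_eq_left h.le]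
      · push Not at h
        rw [min_eq_right h, List.getD_eq_default _ _ le_rfl, List.getD_eq_default _ _ h]

/-- `foldl` of string concatenation is `flatten`. [folklore] -/
theorem foldl_append_eq_flatten (l : List (List Bool)) (acc : List Bool) :
    l.foldl (fun acc a => acc ++ a) acc = acc ++ l.flatten := by
  induction l generalizing acc with
  | nil => simp
  | cons a l ih => rw [List.foldl_cons, ih]; simp

/-- **Concatenating a raw list of strings into one string** (twin of `TQBFRed.strJoin`, see the section
note). [folklore] -/
theorem strFlatten : CodeFP (rawE strE) strE List.flatten := by
  have h := foldl₀ (α := List Bool) (β := List Bool) (eα := strE) (eβ := strE)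
    (step := fun a acc => acc ++ a) (b₀ := []) (strAppend.comp ((snd strE strE).pair (fst strE strE))) X
    (fun l₁ l₂ => by
      rw [foldl_append_eq_flatten, List.nil_append, eval_X]
      refine le_trans ?_ (length_rawE_le_of_sublist strE (List.sublist_append_left l₁ l₂))
      induction l₁ with
      | nil => simp
      | cons a l ih =>
        have ih' : l.flatten.length ≤ (rawE strE l).length := ih
        change (a ++ l.flatten).length ≤ (boolPair a (rawE strE l)).length
        rw [List.length_append, length_boolPair]
        omega)
  exact h.congr fun l => by rw [foldl_append_eq_flatten, List.nil_append]

/-- A raw list of bits, read as a raw list of one-bit strings (same code). [folklore] -/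
theorem rawBitsAsStrs : CodeFP (rawE bitE) (rawE strE) (fun l => l.map bitE) :=
  transparent fun l => by simp [rawE, List.map_map]

/-- **A raw list of bits as a bit string.** [folklore] -/
theorem strOfRawBits : CodeFP (rawE bitE) strE id :=
  (strFlatten.comp rawBitsAsStrs).congr fun l => by
    induction l with
    | nil => rfl
    | cons b l ih => simp [bitE, List.flatten_cons] at ih ⊢; exact ih

/-! ### The backward transcoder: from an instance code to a `k`-CNF code -/

/-- `clauseOf` as a map over `[0, k)`. [folklore] -/
theorem clauseOf_eq_map_range (k n s t : ℕ) :
    clauseOf k n s t = (List.range k).map fun i => (t / n ^ i % n, s.testBit i) := by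
  apply List.ext_getElem
  · simp [clauseOf]
  · intro i h1 h2
    simp [clauseOf]

/-- **`(n, s, t) ↦ clauseOf k n s t` is computed on codes** (a map over the constant budget `[0, k)` with
unary items, dividing by the powers `nⁱ` and testing bit `i` of `s`). [cite: AroraBarak2009, §1.3] -/
theorem codeFP_clauseOf (k : ℕ) :
    CodeFP (pairE natE (pairE natE natE)) (rawE litE) (fun p => clauseOf k p.1 p.2.1 p.2.2) := by
  -- context `(n, s, t)`, item `i` (unary)
  let cE : ℕ × ℕ × ℕ → List Bool := pairE natE (pairE natE natE)
  have hn : CodeFP (pairE cE unE) natE (fun q => q.1.1) := (fst _ _).fst'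
  have hs : CodeFP (pairE cE unE) natE (fun q => q.1.2.1) := (fst _ _).snd'.fst'
  have ht : CodeFP (pairE cE unE) natE (fun q => q.1.2.2) := (fst _ _).snd'.snd'
  have hi : CodeFP (pairE cE unE) unE (fun q => q.2) := snd _ _
  have hvar : CodeFP (pairE cE unE) natE (fun q => q.1.2.2 / q.1.1 ^ q.2 % q.1.1) :=
    natMod.comp ((natDiv.comp (ht.pair (natPow.comp (hn.pair hi)))).pair hn)
  have hbit : CodeFP (pairE cE unE) bitE (fun q => decide (q.1.2.1 / 2 ^ q.2 % 2 = 1)) :=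
    natEq.comp ((natMod.comp ((natDiv.comp (hs.pair (natPow.comp ((const _ 2).pair hi)))).pair
      (const _ 2))).pair (const _ 1))
  have hlit : CodeFP (pairE cE unE) litE (fun q => (q.1.2.2 / q.1.1 ^ q.2 % q.1.1, q.1.2.1.testBit q.2)) :=
    (hvar.pair hbit).congr fun q => by rw [Nat.testBit_eq_decide_div_mod_eq]
  refine ((map hlit).comp ((CodeFP.id cE).pair (const cE (eβ := rawE unE) (List.range k)))).congr fun p => ?_
  rw [clauseOf_eq_map_range]
  rfl

/-- **`(n, bits) ↦ cnfOfBits k n bits` is computed on codes** (filter the set positions of `bits` over the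
budget `[0, |bits|)`, then map each to its clause). [cite: AroraBarak2009, §1.3] -/
theorem codeFP_cnfOfBits (k : ℕ) :
    CodeFP (pairE natE strE) (rawE (rawE litE)) (fun p => cnfOfBits k p.1 p.2) := by
  let cE : ℕ × List Bool → List Bool := pairE natE strE
  -- the set positions
  have hJ : CodeFP cE (rawE natE) (fun p => List.range p.2.length) := urange.comp (strLength.comp (snd natE strE))
  have hbit : CodeFP (pairE cE natE) bitE (fun q => q.1.2.getD q.2 false) :=
    strGetDNat.comp ((fst _ _).snd'.pair (snd _ _))
  have hF : CodeFP cE (rawE natE) (fun p => (List.range p.2.length).filter fun j => p.2.getD j false) :=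
    ((filter hbit).comp ((CodeFP.id cE).pair hJ)).congr fun p => rfl
  -- the clause of a position
  have hN : CodeFP (pairE cE natE) natE (fun q => q.1.1 ^ k) := natPow.comp ((fst _ _).fst'.pair (const _ k))
  have hcl : CodeFP (pairE cE natE) (rawE litE) (fun q => clauseOf k q.1.1 (q.2 / q.1.1 ^ k) (q.2 % q.1.1 ^ k)) :=
    (codeFP_clauseOf k).comp ((fst _ _).fst'.pair ((natDiv.comp ((snd _ _).pair hN)).pair
      (natMod.comp ((snd _ _).pair hN))))
  exact ((map hcl).comp ((CodeFP.id cE).pair hF)).congr fun p => rfl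

/-- **The well-formedness test of an instance code**: the string re-pairs from its decoded header numeral
and its body, and the body has the length `2^k · n^k` of a table string. [folklore] -/
def instOK (k : ℕ) (w : List Bool) : Bool :=
  decide (boolPair (encodeNat (bitsToNat (fstF w))) (sndF w) = w) &&
    decide ((sndF w).length = 2 ^ k * bitsToNat (fstF w) ^ k)

/-- The header numeral and the body of a string. [folklore] -/
theorem codeFP_hdrBody : CodeFP strE (pairE natE strE) (fun w => (bitsToNat (fstF w), sndF w)) :=
  (strVal.comp (of_fn (eα := strE) (eβ := strE) (g := fstF) fstF fstF_mem_FP fun _ => rfl)).pair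
    (of_fn (eα := strE) (eβ := strE) (g := sndF) sndF sndF_mem_FP fun _ => rfl)

/-- `instOK` is computed on codes. [cite: AroraBarak2009, §1.3] -/
theorem codeFP_instOK (k : ℕ) : CodeFP strE bitE (instOK k) := by
  have h1 : CodeFP strE bitE (fun w => decide (boolPair (encodeNat (bitsToNat (fstF w))) (sndF w) = w)) :=
    (CodeFP.eq strE_injective).comp ((codeFP_hdrBody.recodeOut (eγ := strE) fun w => rfl).pair (CodeFP.id strE))
  have h2 : CodeFP strE bitE (fun w => decide ((sndF w).length = 2 ^ k * bitsToNat (fstF w) ^ k)) :=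
    natEq.comp ((strNatLength.comp codeFP_hdrBody.snd').pair (natMul.comp ((const strE (2 ^ k)).pair
      (natPow.comp (codeFP_hdrBody.fst'.pair (const strE k))))))
  exact (h1.and h2).congr fun w => rfl

/-- **The backward map at the level of formulas**: the `k`-CNF of the tables of a well-formed instance code,
and the unsatisfiable `[□]` otherwise. [cite: ImpagliazzoPaturiZaneJCSS2001, §3] -/
def backCNF (k : ℕ) (w : List Bool) : CNF ℕ :=
  if instOK k w then cnfOfBits k (bitsToNat (fstF w)) (sndF w) else [[]]

/-- `backCNF` is computed on codes. [cite: AroraBarak2009, §1.3] -/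
theorem codeFP_backCNF (k : ℕ) : CodeFP strE cnfE (backCNF k) := by
  have hraw : CodeFP strE (rawE (rawE litE)) (fun w => cnfOfBits k (bitsToNat (fstF w)) (sndF w)) :=
    (codeFP_cnfOfBits k).comp codeFP_hdrBody
  have hlist : CodeFP strE cnfE (fun w => cnfOfBits k (bitsToNat (fstF w)) (sndF w)) :=
    ((listOfRaw clauseE).comp ((map₀ (listOfRaw litE)).comp hraw)).congr fun w => by simp
  exact (codeFP_instOK k).ite hlist (const strE [[]])

/-- **The backward map on strings**: `w ↦` the `encodingCNF`-code of `backCNF k w`. [cite: ImpagliazzoPaturiZaneJCSS2001, §3] -/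
def backMap (k : ℕ) (w : List Bool) : List Bool := encodingCNF.encode (backCNF k w)

/-- **The backward map is polynomial time.** [cite: AroraBarak2009, §1.3] -/
theorem backMap_mem_FP (k : ℕ) : backMap k ∈ FP := by
  obtain ⟨f, hf, hfg⟩ := codeFP_backCNF k
  have : f = backMap k := funext fun w => (hfg w).trans (by rw [backMap, encode_eq_cnfE])
  rw [← this]; exact hf

end Codes

/-! ### Correctness of the backward map -/

section Backward

open Brick

/-- The code of an instance: header numeral and table string. [cite: ImpagliazzoPaturiZane2001, §3] -/
theorem encode_inst_eq {k : ℕ} (x : SNPInstance (inAr k)) :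
    (encodingSNPInstance (inAr k)).encode x = boolPair (encodeNat x.1) (List.ofFn (relTablesEquiv (inAr k) x.1 x.2)) :=
  rfl

/-- `List.ofFn` of the entries of a list along a cast of its length is the list. [folklore] -/
theorem ofFn_get_cast {α : Type} {m : ℕ} (l : List α) (h : m = l.length) :
    List.ofFn (fun i : Fin m => l.get (i.cast h)) = l := by
  subst h
  exact List.ofFn_get l

/-- Instance codes pass the well-formedness test. [folklore] -/
theorem instOK_encode {k : ℕ} (x : SNPInstance (inAr k)) : instOK k ((encodingSNPInstance (inAr k)).encode x) = true := by
  rw [encode_inst_eq, instOK, fstF_boolPair, sndF_boolPair, bitsToNat_encodeNat, Bool.and_eq_true, decide_eq_true_eq,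
    decide_eq_true_eq]
  exact ⟨rfl, by rw [List.length_ofFn, tableBits_inAr]⟩

/-- Membership of an instance code in the language of `Φ_k` (`SNPFormula.encode_mem_language_iff` at the
syntactic signature `inAr k`). [folklore] -/
theorem encode_mem_language_iff' {k : ℕ} (x : SNPInstance (inAr k)) :
    (encodingSNPInstance (inAr k)).encode x ∈ (formula k).language ↔ (formula k).HoldsOnTables x.1 x.2 :=
  SNPFormula.encode_mem_language_iff (formula k) x

/-- The parameter of an instance code of `Φ_k` is its universe size. [cite: ImpagliazzoPaturiZaneJCSS2001, §3] -/
theorem param_encode' {k : ℕ} (x : SNPInstance (inAr k)) :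
    (formula k).toParamProblem.param ((encodingSNPInstance (inAr k)).encode x) = x.1 :=
  (SNPFormula.toParamProblem_param_encode (formula k) x).trans (witnessBits_formula k x.1)

/-- **A string passing the well-formedness test is an instance code.** [folklore] -/
theorem exists_encode_of_instOK {k : ℕ} {w : List Bool} (h : instOK k w = true) :
    ∃ x : SNPInstance (inAr k), (encodingSNPInstance (inAr k)).encode x = w := by
  rw [instOK, Bool.and_eq_true, decide_eq_true_eq, decide_eq_true_eq] at h
  obtain ⟨hw, hlen⟩ := h
  set n := bitsToNat (fstF w)
  have hlen' : tableBits (inAr k) n = (sndF w).length := by rw [tableBits_inAr, hlen]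
  let v : Fin (tableBits (inAr k) n) → Bool := fun i => (sndF w).get (i.cast hlen')
  refine ⟨⟨n, (relTablesEquiv (inAr k) n).symm v⟩, ?_⟩
  rw [encode_inst_eq, Equiv.apply_symm_apply, ← hw]
  congr 1
  exact ofFn_get_cast (sndF w) hlen'

/-- The backward map on an instance code. [cite: ImpagliazzoPaturiZaneJCSS2001, §3] -/
theorem backMap_encode {k : ℕ} (x : SNPInstance (inAr k)) :
    backMap k ((encodingSNPInstance (inAr k)).encode x) =
      encodingCNF.encode (cnfOfBits k x.1 (List.ofFn (relTablesEquiv (inAr k) x.1 x.2))) := by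
  rw [backMap, backCNF, if_pos (instOK_encode x), encode_inst_eq, fstF_boolPair, sndF_boolPair, bitsToNat_encodeNat]

/-- The backward map off the instance codes is the non-member `badCode`. [folklore] -/
theorem backMap_of_not_instOK {k : ℕ} {w : List Bool} (h : ¬ instOK k w = true) : backMap k w = KSATRed.badCode := by
  rw [backMap, backCNF, if_neg h]; rfl

/-- **The backward map preserves membership**: `w ∈ L(Φ_k) ↔ backMap k w ∈ kSAT k`.
[cite: ImpagliazzoPaturiZaneJCSS2001, §3] -/
theorem mem_language_iff_backMap_mem (k : ℕ) (w : List Bool) :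
    w ∈ (formula k).language ↔ backMap k w ∈ kSAT k := by
  by_cases h : instOK k w = true
  · obtain ⟨x, rfl⟩ := exists_encode_of_instOK h
    rw [encode_mem_language_iff', backMap_encode, mem_kSAT_iff, satisfiable_cnfOfBits_iff]
    exact ⟨fun hx => ⟨isWidthLE_cnfOfBits _ _ _, hx⟩, fun hx => hx.2⟩
  · rw [backMap_of_not_instOK h]
    constructor
    · rintro ⟨x, -, rfl⟩
      exact absurd (instOK_encode x) h
    · intro hb
      exact absurd hb (KSATRed.badCode_not_mem_kSAT k)

/-- **The parameter of the backward image**: `numVars ≤ n = witnessBits`. [cite: ImpagliazzoPaturiZaneJCSS2001, §3] -/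
theorem param_backMap_le (k : ℕ) (w : List Bool) :
    (kSATParam k).param (backMap k w) ≤ 1 * (formula k).toParamProblem.param w := by
  rw [one_mul]
  by_cases h : instOK k w = true
  · obtain ⟨x, rfl⟩ := exists_encode_of_instOK h
    rw [backMap_encode, kSATParam_param_encode, param_encode']
    exact numVars_cnfOfBits_le (by rw [List.length_ofFn, tableBits_inAr])
  · rw [backMap_of_not_instOK h, SerfRename.param_badCode]
    exact Nat.zero_le _

/-- **The SNP problem of `Φ_k` SERF-reduces to `k`-SAT with parameter `n`.** [cite: ImpagliazzoPaturiZaneJCSS2001, §3, proof of Thm. 3] -/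
theorem serfReducible_formula_kSATParam (k : ℕ) : SERFReducible (formula k).toParamProblem (kSATParam k) :=
  serfReducible_of_karp (backMap k) (backMap_mem_FP k) (mem_language_iff_backMap_mem k) 1 (param_backMap_le k)

end Backward

/-! ### The forward transcoder: from a `k`-CNF code to an instance code -/

section Forward

open CodeFP Brick KSATRed NegCNF

/-- **The total decoder of CNF codes is computed on codes** (the canonical re-encoding `canonCNFFn` of
`KSATReductions.lean`). [cite: AroraBarak2009, §1.3] -/
theorem codeFP_decCNF : CodeFP strE cnfE decCNF :=
  of_fn canonCNFFn canonCNFFn_mem_FP fun w => by rw [canonCNFFn_eq, encode_eq_cnfE]; rfl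

/-- The canonicity test of CNF codes on codes (`isCanonFn`). [cite: AroraBarak2009, §1.3] -/
theorem codeFP_isCanon : CodeFP strE bitE (fun w => decide (encodingCNF.encode (decCNF w) = w)) :=
  of_fn isCanonFn isCanonFn_mem_FP fun w => by rw [isCanonFn_apply]; rfl

/-- The width test on codes (`widthLEFn`). [cite: AroraBarak2009, §1.3] -/
theorem codeFP_isWidthLE (k : ℕ) : CodeFP cnfE bitE (fun φ => decide (CNF.IsWidthLE k φ)) :=
  of_fn (widthLEFn k) (widthLEFn_mem_FP k) fun φ => by rw [← encode_eq_cnfE, widthLEFn_encode]; rfl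

/-- `all (¬ isEmpty)` decides absence of the empty clause. [folklore] -/
theorem all_not_isEmpty_eq (φ : CNF ℕ) : (φ.all fun c => !c.isEmpty) = decide ([] ∉ φ) := by
  rw [Bool.eq_iff_iff, List.all_eq_true, decide_eq_true_eq]
  constructor
  · intro h hmem; simpa using h [] hmem
  · intro h c hc
    cases c with
    | nil => exact absurd hc h
    | cons a c => rfl

/-- The no-empty-clause test on codes. [cite: AroraBarak2009, §1.3] -/
theorem codeFP_noEmpty : CodeFP cnfE bitE (fun φ => decide (([] : Clause ℕ) ∉ φ)) := by
  have hp : CodeFP (pairE unitE clauseE) bitE (fun q => !q.2.isEmpty) :=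
    ((rawIsEmpty litE).comp ((rawOfList litE).comp (snd unitE clauseE))).not
  exact ((all hp).comp ((const cnfE ()).pair (rawOfList clauseE))).congr fun φ => all_not_isEmpty_eq φ

/-- **The literal occurrences of a CNF, on codes.** [cite: AroraBarak2009, §1.3] -/
theorem codeFP_flatten : CodeFP cnfE (rawE litE) (fun φ : CNF ℕ => φ.flatten) :=
  ((CodeFP.flatten litE).comp ((map₀ (rawOfList litE)).comp (rawOfList clauseE))).congr fun φ => by simp

/-- The running maximum of `x + 1` over the literals is `0` or attained. [folklore] -/
theorem foldl_max_succ_eq (L : List (Literal ℕ)) (a : ℕ) :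
    L.foldl (fun acc l => max acc (l.1 + 1)) a = a ∨ ∃ l ∈ L, L.foldl (fun acc l => max acc (l.1 + 1)) a = l.1 + 1 := by
  induction L generalizing a with
  | nil => exact Or.inl rfl
  | cons x L ih =>
    rw [List.foldl_cons]
    rcases ih (max a (x.1 + 1)) with h | ⟨l, hl, h⟩
    · rw [h]
      rcases le_total a (x.1 + 1) with hle | hle
      · exact Or.inr ⟨x, List.mem_cons_self .., max_eq_right hle⟩
      · exact Or.inl (max_eq_left hle)
    · exact Or.inr ⟨l, List.mem_cons_of_mem _ hl, h⟩

/-- `numVars` as a left fold of the running maximum. [folklore] -/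
theorem foldl_max_succ_eq_max_foldr (L : List (Literal ℕ)) (a : ℕ) :
    L.foldl (fun acc l => max acc (l.1 + 1)) a = max a ((L.map fun l => l.1 + 1).foldr max 0) := by
  induction L generalizing a with
  | nil => simp
  | cons x L ih => rw [List.foldl_cons, ih, List.map_cons, List.foldr_cons, max_assoc]

/-- `numVars φ` is the running maximum over the occurrences. [folklore] -/
theorem numVars_eq_foldl (φ : CNF ℕ) : φ.numVars = φ.flatten.foldl (fun acc l => max acc (l.1 + 1)) 0 := by
  rw [foldl_max_succ_eq_max_foldr, Nat.zero_max]; rfl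

/-- **`numVars` on codes** (a fold whose accumulator is a numeral one bit longer than an item at most).
[cite: AroraBarak2009, §1.3 (polynomially bounded loops)] -/
theorem codeFP_numVarsOfLits : CodeFP (rawE litE) natE (fun L : List (Literal ℕ) => L.foldl (fun acc l => max acc (l.1 + 1)) 0) := by
  have hstep : CodeFP (pairE litE natE) natE (fun t => max t.2 (t.1.1 + 1)) :=
    natMax.comp ((snd litE natE).pair (natAdd.comp ((fst litE natE).fst'.pair (const _ 1))))
  exact foldl₀ (step := fun (l : Literal ℕ) acc => max acc (l.1 + 1)) (b₀ := 0) hstep (X + 1) fun l₁ l₂ => by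
    rw [eval_add, eval_X, eval_one]
    rcases foldl_max_succ_eq l₁ 0 with h | ⟨l, hl, h⟩
    · rw [h]; simp
    · rw [h]
      have h1 : (natE (l.1 + 1)).length ≤ (natE l.1).length + 1 := length_encodeNat_succ_le l.1
      have h2 := length_item_le_length_rawE litE (List.mem_append_left l₂ hl)
      have h3 : (litE l).length = 2 * (natE l.1).length + 2 + 1 := by
        change (boolPair (natE l.1) [l.2]).length = _; rw [length_boolPair]; rfl
      omega

/-- `size φ` is the number of occurrences. [folklore] -/
theorem size_eq_length_flatten (φ : CNF ℕ) : φ.size = φ.flatten.length := by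
  rw [CNF.size, List.length_flatten]

/-- **The renaming on codes**, from the context `(b, occs)` = (`numVars ≤ size`, the occurrences):
`v ↦ v` if `b`, else the occurrence rank `#{u ∈ occs | u < v}`. [cite: AroraBarak2009, §1.3] -/
def renumC (ctx : Bool × List ℕ) (v : ℕ) : ℕ := if ctx.1 then v else (ctx.2.filter fun u => decide (u < v)).length

/-- `renumC` is computed on codes. [cite: AroraBarak2009, §1.3] -/
theorem codeFP_renumC : CodeFP (pairE (pairE bitE (rawE natE)) natE) natE (fun p => renumC p.1 p.2) := by
  let cE : (Bool × List ℕ) × ℕ → List Bool := pairE (pairE bitE (rawE natE)) natE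
  have hb : CodeFP cE bitE (fun p => p.1.1) := (fst _ _).fst'
  have hoccs : CodeFP cE (rawE natE) (fun p => p.1.2) := (fst _ _).snd'
  have hv : CodeFP cE natE (fun p => p.2) := snd _ _
  have hcnt : CodeFP cE natE (fun p => (p.1.2.filter fun u => decide (u < p.2)).length) :=
    (natLength natE).comp ((filter (p := fun q : ℕ × ℕ => decide (q.2 < q.1)) (natLt.comp ((snd natE natE).pair
      (fst natE natE)))).comp (hv.pair hoccs))
  exact (hb.ite hv hcnt).congr fun p => rfl

/-- The context of the renaming of `φ`. [folklore] -/
def renumCtx (φ : CNF ℕ) : Bool × List ℕ := (decide (φ.numVars ≤ φ.size), φ.flatten.map Prod.fst)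

/-- `renumC` on the context of `φ` is `renum φ`. [folklore] -/
theorem renumC_renumCtx (φ : CNF ℕ) (v : ℕ) : renumC (renumCtx φ) v = renum φ v := by
  unfold renumC renumCtx renum
  by_cases h : φ.numVars ≤ φ.size
  · simp [h]
  · rw [decide_eq_false h]
    simp only [Bool.false_eq_true, ↓reduceIte, if_neg h]
    rw [SerfRename.rank, List.countP_eq_length_filter]
    rfl

/-- The renaming context on codes. [cite: AroraBarak2009, §1.3] -/
theorem codeFP_renumCtx : CodeFP cnfE (pairE bitE (rawE natE)) renumCtx := by
  have hL := codeFP_flatten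
  have hnv : CodeFP cnfE natE CNF.numVars := (codeFP_numVarsOfLits.comp hL).congr fun φ => (numVars_eq_foldl φ).symm
  have hsz : CodeFP cnfE natE CNF.size := ((natLength litE).comp hL).congr fun φ => (size_eq_length_flatten φ).symm
  exact (natLe.comp (hnv.pair hsz)).pair ((map₀ (fst natE bitE)).comp hL)

/-- **`newNumVars` on codes.** [cite: AroraBarak2009, §1.3] -/
theorem codeFP_newNumVars : CodeFP cnfE natE newNumVars := by
  have hL := codeFP_flatten
  have hnv : CodeFP cnfE natE CNF.numVars := (codeFP_numVarsOfLits.comp hL).congr fun φ => (numVars_eq_foldl φ).symm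
  have hsz : CodeFP cnfE natE CNF.size := ((natLength litE).comp hL).congr fun φ => (size_eq_length_flatten φ).symm
  exact (natMin.comp (hnv.pair hsz)).congr fun φ => rfl

/-- The preprocessing from a renaming context. [folklore] -/
def prepC (k : ℕ) (ctx : Bool × List ℕ) (φ : CNF ℕ) : CNF ℕ :=
  φ.map fun c => padClause k (c.map fun l => (renumC ctx l.1, l.2))

/-- `prepC` on the context of `φ` is `prep`. [folklore] -/
theorem prepC_renumCtx (k : ℕ) (φ : CNF ℕ) : prepC k (renumCtx φ) φ = prep k φ := by
  unfold prepC prep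
  rw [List.map_map]
  refine List.map_congr_left fun c _ => ?_
  simp only [Function.comp_apply, renumC_renumCtx]

/-- **Padding on codes.** [cite: AroraBarak2009, §1.3] -/
theorem codeFP_padClause (k : ℕ) : CodeFP (rawE litE) (rawE litE) (padClause k) :=
  ((padTo litE).comp (((rawHeadOr litE).comp ((const (rawE litE) ((0, false) : Literal ℕ)).pair (CodeFP.id _))).pair
    ((const (rawE litE) (eβ := unE) k).pair (CodeFP.id _)))).congr fun _ => rfl

/-- **The preprocessing on codes.** [cite: AroraBarak2009, §1.3] -/
theorem codeFP_prepC (k : ℕ) : CodeFP (pairE (pairE bitE (rawE natE)) cnfE) (rawE (rawE litE)) (fun p => prepC k p.1 p.2) := by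
  let cE : Bool × List ℕ → List Bool := pairE bitE (rawE natE)
  have g1 : CodeFP (pairE cE litE) litE (fun q => (renumC q.1 q.2.1, q.2.2)) :=
    (codeFP_renumC.comp ((fst _ _).pair (snd _ _).fst')).pair (snd _ _).snd'
  have g2 : CodeFP (pairE cE (rawE litE)) (rawE litE) (fun q => q.2.map fun l => (renumC q.1 l.1, l.2)) := map g1
  have g4 : CodeFP (pairE cE clauseE) (rawE litE) (fun q => padClause k (q.2.map fun l => (renumC q.1 l.1, l.2))) :=
    (codeFP_padClause k).comp (g2.comp ((fst _ _).pair ((rawOfList litE).comp (snd _ _))))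
  exact ((map g4).comp ((fst _ _).pair ((rawOfList clauseE).comp (snd _ _)))).congr fun p => rfl

/-- **The table string from a budget**: positions `j < min (2^k n^k) B`, bit `[clauseOf k n (j / n^k) (j % n^k) ∈ ψ]`.
[cite: ImpagliazzoPaturiZaneJCSS2001, §3] -/
def bitsC (k n : ℕ) (ψ : CNF ℕ) (B : ℕ) : List Bool :=
  (List.range (min (2 ^ k * n ^ k) B)).map fun j => decide (clauseOf k n (j / n ^ k) (j % n ^ k) ∈ ψ)

/-- With a sufficient budget the table string is `bitsOfCNF`. [folklore] -/
theorem bitsC_eq_bitsOfCNF {k n B : ℕ} {ψ : CNF ℕ} (h : 2 ^ k * n ^ k ≤ B) : bitsC k n ψ B = bitsOfCNF k n ψ := by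
  rw [bitsC, min_eq_left h]; rfl

/-- **The table string on codes** (context `(n, ψ)`, budget a unit list). [cite: AroraBarak2009, §1.3] -/
theorem codeFP_bitsC (k : ℕ) :
    CodeFP (pairE (pairE natE (rawE (rawE litE))) (rawE unitE)) strE (fun p => bitsC k p.1.1 p.1.2 p.2.length) := by
  let cE : ℕ × CNF ℕ → List Bool := pairE natE (rawE (rawE litE))
  -- the positions
  have hN0 : CodeFP (pairE cE (rawE unitE)) natE (fun p => 2 ^ k * p.1.1 ^ k) :=
    natMul.comp ((const _ (2 ^ k)).pair (natPow.comp ((fst _ _).fst'.pair (const _ k))))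
  have hJ : CodeFP (pairE cE (rawE unitE)) (rawE natE) (fun p => List.range (min (2 ^ k * p.1.1 ^ k) p.2.length)) :=
    (brange unitE).comp ((snd _ _).pair hN0)
  -- the bit of a position
  have hN : CodeFP (pairE cE natE) natE (fun q => q.1.1 ^ k) := natPow.comp ((fst _ _).fst'.pair (const _ k))
  have hcl : CodeFP (pairE cE natE) (rawE litE) (fun q => clauseOf k q.1.1 (q.2 / q.1.1 ^ k) (q.2 % q.1.1 ^ k)) :=
    (codeFP_clauseOf k).comp ((fst _ _).fst'.pair ((natDiv.comp ((snd _ _).pair hN)).pair (natMod.comp ((snd _ _).pair hN))))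
  have hbit : CodeFP (pairE cE natE) bitE (fun q => decide (clauseOf k q.1.1 (q.2 / q.1.1 ^ k) (q.2 % q.1.1 ^ k) ∈ q.1.2)) :=
    (mem (rawE_injective litE_injective)).comp (hcl.pair (fst _ _).snd')
  exact (strOfRawBits.comp ((map hbit).comp ((fst _ _).pair hJ))).congr fun p => rfl

/-- The unit budget `(2|w| + 2)^k` of an input string. [folklore] -/
theorem codeFP_budget (k : ℕ) : CodeFP strE (rawE unitE) (fun w => List.replicate ((2 * w.length + 2) ^ k) ()) :=
  ((unitsPow k).comp (unSucc.comp (unSucc.comp (unAdd.comp (strLength.pair strLength))))).congr fun w => by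
    dsimp only
    have h : w.length + w.length + 1 + 1 = 2 * w.length + 2 := by omega
    rw [h]

/-- **The acceptance test of the forward map**: a canonical code of a `k`-CNF without the empty clause. [folklore] -/
def fwdOK (k : ℕ) (w : List Bool) : Bool :=
  decide (encodingCNF.encode (decCNF w) = w) && (decide (CNF.IsWidthLE k (decCNF w)) && decide (([] : Clause ℕ) ∉ decCNF w))

/-- `fwdOK` on codes. [cite: AroraBarak2009, §1.3] -/
theorem codeFP_fwdOK (k : ℕ) : CodeFP strE bitE (fwdOK k) :=
  codeFP_isCanon.and (((codeFP_isWidthLE k).comp codeFP_decCNF).and (codeFP_noEmpty.comp codeFP_decCNF))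

/-- **The forward map on strings**: the code of the instance `(newNumVars φ, tables of prep k φ)` of the
decoded `k`-CNF `φ` (table string computed within the budget `(2|w|+2)^k`), and the non-code `ε` off the
accepted inputs. [cite: ImpagliazzoPaturiZaneJCSS2001, §3] -/
def fwdMap (k : ℕ) (w : List Bool) : List Bool :=
  if fwdOK k w then
    boolPair (encodeNat (newNumVars (decCNF w)))
      (bitsC k (newNumVars (decCNF w)) (prep k (decCNF w)) ((2 * w.length + 2) ^ k))
  else []

/-- **The forward map is polynomial time.** [cite: AroraBarak2009, §1.3] -/
theorem fwdMap_mem_FP (k : ℕ) : fwdMap k ∈ FP := by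
  have hφ := codeFP_decCNF
  have hn : CodeFP strE natE (fun w => newNumVars (decCNF w)) := codeFP_newNumVars.comp hφ
  have hψ : CodeFP strE (rawE (rawE litE)) (fun w => prep k (decCNF w)) :=
    ((codeFP_prepC k).comp ((codeFP_renumCtx.comp hφ).pair hφ)).congr fun w => prepC_renumCtx k (decCNF w)
  have hbits : CodeFP strE strE (fun w => bitsC k (newNumVars (decCNF w)) (prep k (decCNF w)) ((2 * w.length + 2) ^ k)) :=
    ((codeFP_bitsC k).comp ((hn.pair hψ).pair (codeFP_budget k))).congr fun w => by simp
  have hout : CodeFP strE strE (fun w => boolPair (encodeNat (newNumVars (decCNF w)))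
      (bitsC k (newNumVars (decCNF w)) (prep k (decCNF w)) ((2 * w.length + 2) ^ k))) :=
    (hn.pair hbits).recodeOut fun w => rfl
  obtain ⟨f, hf, hfg⟩ := (codeFP_fwdOK k).ite hout (const strE ([] : List Bool))
  have : f = fwdMap k := funext fun w => (hfg w).trans rfl
  rw [← this]; exact hf

end Forward

/-! ### Correctness of the forward map -/

section ForwardCorrect

open CodeFP Brick KSATRed NegCNF

/-- A CNF code is at least as long as the size of the formula. [folklore] -/
theorem size_le_length_encode (φ : CNF ℕ) : φ.size ≤ (encodingCNF.encode φ).length := by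
  rw [encode_eq_cnfE]
  change φ.size ≤ (boolPair (unE φ.length) (rawE clauseE φ)).length
  rw [length_boolPair, length_rawE, CNF.size]
  have h : (φ.map List.length).sum ≤ (φ.map fun c => 2 * (clauseE c).length + 2).sum :=
    List.sum_le_sum fun c _ => by
      change c.length ≤ 2 * (boolPair (unE c.length) (rawE litE c)).length + 2
      rw [length_boolPair, length_unE]; omega
  omega

/-- The budget `(2|w|+2)^k` covers the table string of the instance of the coded formula. [folklore] -/
theorem tableBits_le_budget (k : ℕ) (φ : CNF ℕ) :
    2 ^ k * newNumVars φ ^ k ≤ (2 * (encodingCNF.encode φ).length + 2) ^ k := by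
  rw [← mul_pow]
  apply Nat.pow_le_pow_left
  have h1 := newNumVars_le_size φ
  have h2 := size_le_length_encode φ
  omega

/-- Unfolding the acceptance test. [folklore] -/
theorem fwdOK_iff (k : ℕ) (w : List Bool) :
    fwdOK k w = true ↔ encodingCNF.encode (decCNF w) = w ∧ CNF.IsWidthLE k (decCNF w) ∧ ([] : Clause ℕ) ∉ decCNF w := by
  simp [fwdOK]

/-- **The forward map on the code of an accepted `k`-CNF is the code of its instance.** [cite: ImpagliazzoPaturiZaneJCSS2001, §3] -/
theorem fwdMap_encode_of {k : ℕ} {φ : CNF ℕ} (hw : φ.IsWidthLE k) (hne : ([] : Clause ℕ) ∉ φ) :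
    fwdMap k (encodingCNF.encode φ) = (encodingSNPInstance (inAr k)).encode (instOf k φ) := by
  have hok : fwdOK k (encodingCNF.encode φ) = true := by
    rw [fwdOK_iff, decCNF_encode]; exact ⟨rfl, hw, hne⟩
  rw [fwdMap, if_pos hok, decCNF_encode, bitsC_eq_bitsOfCNF (tableBits_le_budget k φ), encode_inst_eq, instOf,
    ofFn_relTablesEquiv_relOfCNF]

/-- The forward map off the accepted inputs is `ε`. [folklore] -/
theorem fwdMap_of_not {k : ℕ} {w : List Bool} (h : ¬ fwdOK k w = true) : fwdMap k w = [] := by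
  rw [fwdMap, if_neg h]

/-- Instance codes are non-empty strings. [folklore] -/
theorem encode_inst_ne_nil {k : ℕ} (x : SNPInstance (inAr k)) : (encodingSNPInstance (inAr k)).encode x ≠ [] := by
  intro h
  have := congrArg List.length h
  rw [encode_inst_eq, length_boolPair, List.length_nil] at this
  omega

/-- `ε` is not in the language of `Φ_k`. [folklore] -/
theorem nil_not_mem_language (k : ℕ) : ([] : List Bool) ∉ (formula k).language := by
  rintro ⟨x, -, hx⟩
  exact encode_inst_ne_nil x hx

/-- **The forward map preserves membership**: `w ∈ kSAT k ↔ fwdMap k w ∈ L(Φ_k)`.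
[cite: ImpagliazzoPaturiZaneJCSS2001, §3] -/
theorem mem_kSAT_iff_fwdMap_mem (k : ℕ) (w : List Bool) : w ∈ kSAT k ↔ fwdMap k w ∈ (formula k).language := by
  by_cases h : fwdOK k w = true
  · obtain ⟨hc, hw, hne⟩ := (fwdOK_iff k w).1 h
    rw [← hc, fwdMap_encode_of hw hne, mem_kSAT_iff, encode_mem_language_iff', holdsOnTables_instOf_iff hw hne]
    exact ⟨fun h' => h'.2, fun h' => ⟨hw, h'⟩⟩
  · rw [fwdMap_of_not h]
    constructor
    · intro hmem
      exfalso
      apply h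
      rw [fwdOK_iff]
      have hc : encodingCNF.encode (decCNF w) = w := encode_decCNF_of_mem hmem
      have hmem' : encodingCNF.encode (decCNF w) ∈ kSAT k := by rw [hc]; exact hmem
      rw [mem_kSAT_iff] at hmem'
      exact ⟨hc, hmem'.1, fun h0 => CNF.not_satisfiable_of_nil_mem h0 hmem'.2⟩
    · intro hmem
      exact absurd hmem (nil_not_mem_language k)

/-- The parameter of an `ofEncoding` problem vanishes off the codewords. [folklore] -/
theorem ofEncoding_param_eq_zero {α : Type} (e : Encoding α Bool) (S : Set α) (p : α → ℕ) {x : List Bool}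
    (h : ∀ a, e.encode a ≠ x) : (ParamProblem.ofEncoding e S p).param x = 0 := by
  unfold ParamProblem.ofEncoding
  dsimp only
  split
  · rename_i a _
    exact if_neg (h a)
  · rfl

/-- **The parameter of the forward image**: `witnessBits = newNumVars φ ≤ numVars φ`. [cite: ImpagliazzoPaturiZaneJCSS2001, §3] -/
theorem param_fwdMap_le (k : ℕ) (w : List Bool) :
    (formula k).toParamProblem.param (fwdMap k w) ≤ 1 * (kSATParam k).param w := by
  rw [one_mul]
  by_cases h : fwdOK k w = true
  · obtain ⟨hc, hw, hne⟩ := (fwdOK_iff k w).1 h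
    rw [← hc, fwdMap_encode_of hw hne, param_encode', kSATParam_param_encode]
    exact newNumVars_le_numVars _
  · rw [fwdMap_of_not h]
    have h0 : (formula k).toParamProblem.param [] = 0 :=
      ofEncoding_param_eq_zero _ _ _ fun x => encode_inst_ne_nil (k := k) x
    rw [h0]
    exact Nat.zero_le _

/-- **`k`-SAT with parameter `n` SERF-reduces to the SNP problem of `Φ_k`.** [cite: ImpagliazzoPaturiZaneJCSS2001, §3, proof of Thm. 3] -/
theorem serfReducible_kSATParam_formula (k : ℕ) : SERFReducible (kSATParam k) (formula k).toParamProblem :=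
  serfReducible_of_karp (fwdMap k) (fwdMap_mem_FP k) (mem_kSAT_iff_fwdMap_mem k) 1 (param_fwdMap_le k)

end ForwardCorrect

end KSatSNP

/-- **Discharge of `exists_snp_kSAT`** (Impagliazzo–Paturi–Zane 2001, §3, proof of Thm. 3: "`k`-SAT is in
SNP"). For every `k`, the SNP formula `KSatSNP.formula k` — inputs `2^k` relations `R_s` of arity `k` (one per
sign pattern), witness one unary relation `S` (the assignment; parameter = the universe size `n`), sentence
`∀ x̄ ⋀_s (R_s(x̄) → ⋁_i (S(x_i) ↔ s_i))` — defines a parameterised problem SERF-equivalent to `kSATParam k`: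
both reductions are polynomial-time re-encodings with one oracle query whose parameter is at most the
input's (`KSatSNP.fwdMap`: rename the occurring variables into an initial segment of size
`min (numVars) (size) ≤ numVars`, pad clauses to width `k`, tabulate; `KSatSNP.backMap`: list the clauses of
the set table bits, `numVars ≤ n`), packaged by `serfReducible_of_karp`.
[cite: ImpagliazzoPaturiZaneJCSS2001, §3, proof of Thm. 3 (k-SAT ∈ SNP)] -/
theorem exists_snp_kSAT_holds : exists_snp_kSAT := fun k =>
  ⟨KSatSNP.formula k, KSatSNP.serfReducible_kSATParam_formula k, KSatSNP.serfReducible_formula_kSATParam k⟩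

end Literature.Computability.FineGrained
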